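import Mathlib.Analysis.Calculus.ImplicitContDiff
import Mathlib.Analysis.Calculus.ContDiff.RCLike
import Mathlib.Analysis.Calculus.FDeriv.Symmetric
import Mathlib.Analysis.Calculus.Deriv.Prod
import Mathlib.Analysis.Calculus.Deriv.Comp
import Mathlib.Analysis.Calculus.Deriv.Mul
import Mathlib.Analysis.Calculus.Deriv.Inv
import Mathlib.Analysis.Calculus.Deriv.Slope
import Mathlib.Analysis.Calculus.MeanValue
import Mathlib.Analysis.Calculus.BumpFunction.FiniteDimension
import Literature.Analysis.Calculus.HadamardLemma
import HarnessLib

/-!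
# Feldman–Salmhofer–Trubowitz II, Appendix A: the `C²` Morse lemmas

Topic `Literature/MathematicalPhysics/QuantumLattice/FermiRG`; a THEOREM-ONLY companion of
`FST2Hypotheses.lean` / `FST2Regularity.lean` (gate-hubbard-kl typer wave, source FST II;
D-0064: one file per source section — this is Appendix A). Source:

* [II] J. Feldman, M. Salmhofer, E. Trubowitz, *Perturbation theory around non-nested Fermi
  surfaces II. Regularity of the moving Fermi surface: RPA contributions*, Comm. Pure Appl.
  Math. **51** (1998) 1133–1246, arXiv:cond-mat/9701073 (`FeldmanSalmhoferTrubowitz1998`),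
  **Appendix A "The `C²` Morse Lemmas"**, p.30 L59–p.31 L198 of the `lit read
  arxiv:cond-mat/9701073` render (locators `p.N Lm` = chunk/line of the arXiv TeX; the lemma /
  theorem numbers of the appendix are lost in the render and are called here Lemma A.1 (the
  zero set, p.30 L69–90) and Theorem A.2 (the factorisation, p.30 L94–107), in print order).

[II] p.30 L61–67: "In this Appendix, we prove the `C²` Morse Lemmas that we need to prove
Theorem [1.1]. The proof of the Morse Lemma for smooth functions is in many textbooks, but our
functions are only `C²`, which makes the proof less straightforward. One proof of the `C²` Morse
lemma can be found in [MW]. For convenience of the reader, we include another proof here."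
Appendix B (the proof of [II] Theorem 1.1 = the named fact `FermiRG.VolumeBound` of
`FST2Regularity.lean`) invokes exactly these two statements after reducing the two-loop phase
space integral near a critical point to the normal form (p.35 L47–106: "by Theorem [A.2] there
is a change of variables `(φ₁,φ₂) → (x,y)` such that `ν(φ₁,φ₂) = xy`" — the case the factor
`ε|log ε|` of Theorem 1.1 comes from); Chapter 3 (`\Lem\jaythree`, "The singularities of the
Jacobian", p.15) uses the same normal form. Neither Mathlib nor the tree has a Morse lemma
(local normal form at a non-degenerate critical point) in any regularity; this file is the
first brick of a Lean proof of Theorem 1.1.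

## What is proved (all sorry-free theorems; no definitions, no named facts)

For `ν : ℝ × ℝ → ℝ` of class `C²` with `ν(0) = 0`, `Dν(0) = 0` and Hessian
`D²ν(0) = diag(-1, 1)` (the three entries `iteratedFDeriv ℝ 2 ν 0 ![eᵢ, eⱼ]`, exactly the
printed normalisation `∂₁²ν(0,0) = -1`, `∂₂²ν(0,0) = 1`, `∂₁∂₂ν(0,0) = 0`):

* `morseC2_hyperbolic_zero_branches` — **Lemma A.1**: there are `ψ₊, ψ₋ : ℝ → ℝ`, `C¹` at `0`
  (hence on a neighbourhood, `ContDiffAt.eventually`), with `ψ_±(0) = 0`, `ψ'_±(0) = ±1`,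
  `ν(a, ψ_±(a)) = 0` for `a` near `0`; moreover (what the printed proof shows on the way,
  p.31 L12–21 "so it has exactly two zeroes", L46–56 "`ψ_±` is `C¹` away from `φ₁ = 0`"):
  `ψ_±` are `C²` and distinct on a punctured neighbourhood of `0`, and ON A NEIGHBOURHOOD OF
  `(0,0)` THE ZERO SET OF `ν` IS EXACTLY THE UNION OF THE TWO GRAPHS.
* `morseC2_hyperbolic_factorisation` — **Theorem A.2**: there are `x, y : ℝ × ℝ → ℝ`, `C¹` at
  `0`, with `ν = x · y` on a neighbourhood of `0`, `x(0) = y(0) = 0`, `Dx(0) = (h,k) ↦ k - h`,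
  `Dy(0) = (h,k) ↦ (h+k)/2` (so `D(x,y)(0)` is invertible: `(x, y)` is a local `C¹` change of
  variables, as App. B uses it).
* `morseC2_hyperbolic_zero_branches_local`, `morseC2_hyperbolic_factorisation_local` — the
  same two statements under the PRINTED hypothesis "`ν` a `C²` function in a neighbourhood of
  `(0,0)`" (p.30 L70), typed `∀ᶠ p in 𝓝 0, ContDiffAt ℝ 2 ν p` (reduction to the global case
  by a smooth planar cutoff, which changes neither the 2-jet at `0` nor the germ of the zero
  set).
* `morseC2_elliptic_radial`, `morseC2_elliptic_jacobian` — **the elliptic case** (p.31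
  L90–110: `ν(0)=0`, `Dν(0)=0`, `D²ν(0) = 1`; "`R = ν`, `θ` = the polar angle; then
  `R(0,0) = 0`, `R` is increasing on each fixed ray `θ = const` and the Jacobian
  `∂(R,θ)/∂(φ₁,φ₂) = 1 + o(1)`"): on a punctured neighbourhood of `0`, `t ↦ ν(tp)` is
  strictly increasing on `[0,1]` and `ν(p) > 0`; and `(φ₁∂₁ν + φ₂∂₂ν)/(φ₁² + φ₂²) → 1`
  (which IS the Jacobian determinant `∂(R,θ)/∂(φ₁,φ₂)`, p.31 L150–161).
* The intermediate statements of the printed proof, as reusable (public, cited) theorems: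
  `morseC2_exists_posBranch` / `morseC2_exists_negBranch` (each branch with `0 < ψ₊(a)/a < 2`,
  `-2 < ψ₋(a)/a < 0`, transversality `∂₂ν(a, ψ₊(a)) ≠ 0` and `ψ₊' = -∂₁ν/∂₂ν` off `0`),
  `morseC2_contDiffAt_of_unique_zero` (the implicit-function-theorem transfer: a locally unique
  zero branch through a transversal zero is `C²`), `morseC2_contDiffAt_one_of_punctured`,
  `morseC2_tendsto_quotient` (the `o(1)` computation of `ψ'_±` at `0`, p.31 L58–71),
  `morseC2_exists_zeros`, `morseC2_exists_box`, `morseC2_ray_pos` / `morseC2_ray_neg` ((R1)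
  read on rays) and `morseC2_zeros_of_strictMonoOn_deriv` (a function with strictly increasing
  derivative has at most two zeros, with the signs of the derivative there). Pure plumbing
  (coordinates of (bi)linear maps on `ℝ × ℝ`, chain rules along rays and slices, the
  reflection `(a,b) ↦ (-a,b)`, the smooth cutoff) is `private`.

## Proof (follows [II] p.30 L109–p.31 L89; deviations named)

[II]: write `ν = -½αφ₁² + βφ₁φ₂ + ½γφ₂²` with continuous `α, β, γ → 1, 0, 1` (Taylor with
integral remainder), bracket the two zeros of the strictly convex slice `φ₂ ↦ ν(φ₁,φ₂)`
between `±φ₁ min Ψ_±` and `±φ₁ max Ψ_±` by the quadratic formula, get `ψ_±` by the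
intermediate value theorem, `ψ'_± = -∂₁ν/∂₂ν` off `0` (no double zero), and continuity of
`ψ'_±` at `0` by an `o(1)` computation. Here: (1) the slices are strictly convex on a box
(`∂₂²ν ≥ ½`, continuity) — `morseC2_exists_box`, `morseC2_strictMonoOn_slice`; (2) instead of
the quadratic-formula bracket we use the sign of `ν` along the rays `a ↦ (a, s a)` for fixed
`s` (`ν(a, sa) ≷ 0` for small `a ≠ 0` according as `s² ≷ 1`: the one-dimensional `C²` fact
applied to `D²ν(0)(1,s)(1,s) = s² - 1`) — `morseC2_ray_pos/neg`; with `s = 0, ±2` this gives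
the two zeros in `(0, 2|a|)` and `(-2|a|, 0)` (`morseC2_exists_zeros`), and with `s = 1 ± ε`
it localises the zero with the sign of `a` in `((1-ε)a, (1+ε)a)`, i.e. `ψ₊(a)/a → 1`; (3) a
function with strictly increasing derivative has at most two zeros (Rolle), so these are ALL
the zeros of the slice in the box and `∂₂ν ≠ 0` at them (`morseC2_zeros_of_strictMonoOn_deriv`);
(4) off `a = 0`, Mathlib's `C²` implicit function theorem (`ContDiffAt.implicitFunction`) at
the transversal zero, identified with `ψ₊` by the uniqueness (3) —
`morseC2_contDiffAt_of_unique_zero`, which also yields `ψ₊' = -∂₁ν/∂₂ν` by differentiating `ν(a, ψ₊(a)) = 0`; (5) at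
`a = 0`: `ψ₊'(0) = lim ψ₊(a)/a = 1`, and `ψ₊'(a) → 1` by `∂₁ν(p) = -p₁ + o(|p|)`,
`∂₂ν(p) = p₂ + o(|p|)` along `p = (a, ψ₊(a)) = O(a)` (`morseC2_tendsto_quotient`), whence `C¹`
at `0` (`morseC2_contDiffAt_one_of_punctured`, via `contDiffOn_succ_iff_deriv_of_isOpen`);
(6) `ψ₋` is the positive branch of the reflected function `ν(-a, b)` (`morseC2_reflect`);
(7) Theorem A.2 exactly as printed: `x = φ₂ - ψ₊(φ₁)`,
`y = ∫₀¹ ∂₂ν(φ₁, (1-t)ψ₊(φ₁) + tφ₂) dt`, `ν = xy` by the fundamental theorem of calculus on the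
vertical segment, `y ∈ C¹` by differentiation under the integral sign
(`Literature.Analysis.Calculus.contDiff_intervalIntegral`, after replacing `ψ₊` by a globally
`C¹` function that agrees with it near `0`, `morseC2_exists_global_contDiff` — a smooth cutoff),
and `Dy(0)` computed from `∂ₚ` of the integrand (`hasFDerivAt_intervalIntegral_partialFDerivFst`).

## Faithfulness notes (for the referee)

* HYPOTHESIS. [II] assumes `ν ∈ C²` "in a neighbourhood of `(0,0)`"; the main development
  assumes `ContDiff ℝ 2 ν` on all of `ℝ × ℝ` (the form App. B needs: its `ν` is a `C²`
  function on `ℝ²`, p.35 L55–60) and concludes locally (filters `𝓝 0`, `𝓝[≠] 0`); the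
  `_local` versions carry the printed germ hypothesis. "`C¹` in a neighbourhood of `0`" is
  typed `ContDiffAt ℝ 1 · 0`, which is equivalent (`ContDiffAt.eventually`).
* DERIVATIVE TABLE OF THEOREM A.2. The print (p.30 L100–107) lists `∂₁x(0,0) = 1`,
  `∂₂x(0,0) = -1`, `∂₁y(0,0) = -1/2`, `∂₂y(0,0) = 1/2`. This is a sign slip: it contradicts
  `ν = xy` (it would give `xy = -(φ₁-φ₂)²/2`, while `ν = (φ₂²-φ₁²)/2 + o(|φ|²)`) and the
  proof's own `x = φ₂ - ψ₊(φ₁)` (p.31 L86–88: "that `∂₁x(0,0) = -1` and that `∂₂x(0,0) = 1`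
  are all obvious, and so are the statements for `y`"). We type what the proof establishes and
  the kernel certifies: `Dx(0) = (h,k) ↦ k - h`, `Dy(0) = (h,k) ↦ (h+k)/2`.
* The zero-set characterisation and the `C²`-regularity off `0` are not in the printed
  STATEMENT of Lemma A.1 but in its proof (p.31 L12–21, L46–56); they are what App. B uses.

## What is NOT here

* Of the elliptic case: the tautological rewriting `x = √(2R) cos θ`, `y = √(2R) sin θ`,
  `ν = ½(x² + y²)` and the Jacobian `∂(x,y)/∂(φ₁,φ₂) = 1 + o(1)` (p.31 L111–127, L163–170) as
  separate statements (their content is `morseC2_elliptic_radial` + `morseC2_elliptic_jacobian`);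
  a germ version of the elliptic statements. Appendix B itself (the proof of Theorem 1.1; the
  model integrals `∫ 𝟙(|f₀ + xy| ≤ ε) dx dy ≤ C ε|log ε|`, `∫ 𝟙(|f₀ + R| ≤ ε) ≤ 8πε`) and any
  `d ≥ 3` statement.
* Anything model-specific (Hubbard band, Kohn–Luttinger programme): this is pure calculus on
  `ℝ²`, placed in `FermiRG/` as a section of the source [II] per the wave's file convention.
-/

open Set Filter Topology Asymptotics

noncomputable section

namespace Literature.MathematicalPhysics.QuantumLattice.FermiRG


/-! ### 1-D sign lemma -/

/-- If `f 0 = 0`, `f` has derivative `f'` near `0` with `f' 0 = 0` and `f'` has derivative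
`c > 0` at `0`, then `f > 0` on a punctured neighbourhood of `0`. [folklore] -/
private theorem morseC2_eventually_pos_of_deriv2_pos {f f' : ℝ → ℝ} {c : ℝ} (h0 : f 0 = 0)
    (hd : ∀ᶠ t in 𝓝 0, HasDerivAt f (f' t) t) (hf'0 : f' 0 = 0) (hf'' : HasDerivAt f' c 0)
    (hc : 0 < c) : ∀ᶠ t in 𝓝[≠] 0, 0 < f t := by
  -- `|f' t - c t| ≤ (c/2) |t|` near `0`
  have h1 : ∀ᶠ t in 𝓝 0, |f' t - c * t| ≤ c / 2 * |t| := by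
    have := (hasDerivAt_iff_isLittleO.1 hf'').def (half_pos hc)
    filter_upwards [this] with t ht
    simpa [hf'0, mul_comm] using ht
  obtain ⟨δ, hδ, hball⟩ := Metric.eventually_nhds_iff.1 (hd.and h1)
  have hball' : ∀ t, |t| < δ → HasDerivAt f (f' t) t ∧ |f' t - c * t| ≤ c / 2 * |t| :=
    fun t ht => hball (by simpa [Real.dist_eq] using ht)
  have hpos : ∀ t, |t| < δ → 0 < t → 0 < f' t := by
    intro t ht htp
    have h := (hball' t ht).2
    rw [abs_of_pos htp] at h
    have := (abs_le.1 h).1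
    nlinarith
  have hneg : ∀ t, |t| < δ → t < 0 → f' t < 0 := by
    intro t ht htn
    have h := (hball' t ht).2
    rw [abs_of_neg htn] at h
    have := (abs_le.1 h).2
    nlinarith
  have hmem : ∀ᶠ t in 𝓝[≠] (0 : ℝ), |t| < δ ∧ t ≠ 0 := by
    have h2 : ∀ᶠ t in 𝓝 (0 : ℝ), |t| < δ :=
      Metric.eventually_nhds_iff.2 ⟨δ, hδ, fun t ht => by simpa [Real.dist_eq] using ht⟩
    exact (h2.filter_mono nhdsWithin_le_nhds).and self_mem_nhdsWithin
  filter_upwards [hmem] with t ⟨ht, ht0⟩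
  have habs : ∀ s, min t 0 ≤ s → s ≤ max t 0 → |s| < δ := by
    intro s hs1 hs2
    have := abs_lt.1 ht
    rw [abs_lt]
    constructor
    · have := min_le_iff.1 hs1; rcases this with h | h <;> linarith
    · have := le_max_iff.1 hs2; rcases this with h | h <;> linarith
  have hcont : ∀ s, min t 0 ≤ s → s ≤ max t 0 → ContinuousWithinAt f (Icc (min t 0) (max t 0)) s :=
    fun s hs1 hs2 => ((hball' s (habs s hs1 hs2)).1.continuousAt).continuousWithinAt
  have hcon : ContinuousOn f (Icc (min t 0) (max t 0)) := fun s hs => hcont s hs.1 hs.2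
  rcases lt_or_gt_of_ne ht0 with htn | htp
  · -- t < 0: MVT on [t, 0]
    have hmin : min t 0 = t := min_eq_left htn.le
    have hmax : max t 0 = 0 := max_eq_right htn.le
    rw [hmin, hmax] at hcon habs
    obtain ⟨ξ, hξ, hξeq⟩ := exists_hasDerivAt_eq_slope f f' htn hcon
      (fun s hs => (hball' s (habs s hs.1.le hs.2.le)).1)
    have hξneg : f' ξ < 0 := hneg ξ (habs ξ hξ.1.le hξ.2.le) hξ.2
    rw [hξeq, h0] at hξneg
    have ht' : 0 < 0 - t := by linarith
    have := div_neg_iff.1 hξneg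
    rcases this with ⟨h1, _⟩ | ⟨_, h2⟩
    · linarith
    · linarith
  · -- 0 < t: MVT on [0, t]
    have hmin : min t 0 = 0 := min_eq_right htp.le
    have hmax : max t 0 = t := max_eq_left htp.le
    rw [hmin, hmax] at hcon habs
    obtain ⟨ξ, hξ, hξeq⟩ := exists_hasDerivAt_eq_slope f f' htp hcon
      (fun s hs => (hball' s (habs s hs.1.le hs.2.le)).1)
    have hξpos : 0 < f' ξ := hpos ξ (habs ξ hξ.1.le hξ.2.le) hξ.1
    rw [hξeq, h0] at hξpos
    have := div_pos_iff.1 hξpos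
    rcases this with ⟨h1, _⟩ | ⟨_, h2⟩
    · linarith
    · linarith

/-- The mirror statement: `f'' (0) = c < 0` gives `f < 0` on a punctured neighbourhood. [folklore] -/
private theorem morseC2_eventually_neg_of_deriv2_neg {f f' : ℝ → ℝ} {c : ℝ} (h0 : f 0 = 0)
    (hd : ∀ᶠ t in 𝓝 0, HasDerivAt f (f' t) t) (hf'0 : f' 0 = 0) (hf'' : HasDerivAt f' c 0)
    (hc : c < 0) : ∀ᶠ t in 𝓝[≠] 0, f t < 0 := by
  have h := morseC2_eventually_pos_of_deriv2_pos (f := fun t => -f t) (f' := fun t => -f' t)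
    (c := -c) (by simp [h0]) (hd.mono fun t ht => ht.neg) (by simp [hf'0]) hf''.neg (by linarith)
  exact h.mono fun t ht => by linarith


/-! ### 1-D: zeros of a function with strictly increasing derivative -/

/-- Rolle on a subinterval: two zeros `z₁ < z₂` inside `Ioo (-ρ) ρ`, where `φ` has derivative
`φ'`, give a zero of `φ'` strictly between them. [folklore] -/
private theorem morseC2_exists_deriv_zero {φ φ' : ℝ → ℝ} {ρ z₁ z₂ : ℝ}
    (hd : ∀ b ∈ Ioo (-ρ) ρ, HasDerivAt φ (φ' b) b) (hz₁ : z₁ ∈ Ioo (-ρ) ρ)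
    (hz₂ : z₂ ∈ Ioo (-ρ) ρ) (hlt : z₁ < z₂) (h₁ : φ z₁ = 0) (h₂ : φ z₂ = 0) :
    ∃ ξ ∈ Ioo z₁ z₂, φ' ξ = 0 := by
  have hsub : Icc z₁ z₂ ⊆ Ioo (-ρ) ρ := fun b hb => ⟨hz₁.1.trans_le hb.1, hb.2.trans_lt hz₂.2⟩
  exact exists_hasDerivAt_eq_zero hlt
    (fun b hb => (hd b (hsub hb)).continuousAt.continuousWithinAt) (h₁.trans h₂.symm)
    (fun b hb => hd b (hsub (Ioo_subset_Icc_self hb)))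

/-- If `φ'` is strictly monotone on `Ioo (-ρ) ρ` and `φ` (with derivative `φ'`) has two zeros
`z₁ < z₂` there, then `φ' z₁ < 0 < φ' z₂` and these are the only zeros in the interval — the
step "in a neighbourhood of the origin `∂₂²ν > 0`, so that `ν`, viewed as a function of `φ₂`, is
strictly convex and can have at most two zeroes" and "for the denominator `∂₂ν` to vanish `ψ_±`
must be a double zero … this cannot happen" of [II] App. A (p.31 L16–21, L52–55), as a
one-dimensional statement (Rolle). [cite: FeldmanSalmhoferTrubowitz1998, App. A, proof of Lemma A.1 (arXiv p.31 L16–21, L52–55)] -/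
theorem morseC2_zeros_of_strictMonoOn_deriv {φ φ' : ℝ → ℝ} {ρ z₁ z₂ : ℝ}
    (hd : ∀ b ∈ Ioo (-ρ) ρ, HasDerivAt φ (φ' b) b) (hmono : StrictMonoOn φ' (Ioo (-ρ) ρ))
    (hz₁ : z₁ ∈ Ioo (-ρ) ρ) (hz₂ : z₂ ∈ Ioo (-ρ) ρ) (hlt : z₁ < z₂) (h₁ : φ z₁ = 0)
    (h₂ : φ z₂ = 0) :
    (φ' z₁ < 0 ∧ 0 < φ' z₂) ∧ ∀ b ∈ Ioo (-ρ) ρ, φ b = 0 → b = z₁ ∨ b = z₂ := by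
  obtain ⟨ξ, hξ, hξ0⟩ := morseC2_exists_deriv_zero hd hz₁ hz₂ hlt h₁ h₂
  have hξI : ξ ∈ Ioo (-ρ) ρ := ⟨hz₁.1.trans hξ.1, hξ.2.trans hz₂.2⟩
  refine ⟨⟨?_, ?_⟩, fun b hb hb0 => ?_⟩
  · have := hmono hz₁ hξI hξ.1; rwa [hξ0] at this
  · have := hmono hξI hz₂ hξ.2; rwa [hξ0] at this
  by_contra hne
  push Not at hne
  -- a third zero produces two distinct zeros of `φ'`, contradicting strict monotonicity
  have key : ∀ {x₁ x₂ x₃ : ℝ}, x₁ ∈ Ioo (-ρ) ρ → x₂ ∈ Ioo (-ρ) ρ → x₃ ∈ Ioo (-ρ) ρ →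
      x₁ < x₂ → x₂ < x₃ → φ x₁ = 0 → φ x₂ = 0 → φ x₃ = 0 → False := by
    intro x₁ x₂ x₃ hx₁ hx₂ hx₃ h12 h23 e₁ e₂ e₃
    obtain ⟨η, hη, hη0⟩ := morseC2_exists_deriv_zero hd hx₁ hx₂ h12 e₁ e₂
    obtain ⟨η', hη', hη'0⟩ := morseC2_exists_deriv_zero hd hx₂ hx₃ h23 e₂ e₃
    have hηI : η ∈ Ioo (-ρ) ρ := ⟨hx₁.1.trans hη.1, hη.2.trans hx₂.2⟩
    have hη'I : η' ∈ Ioo (-ρ) ρ := ⟨hx₂.1.trans hη'.1, hη'.2.trans hx₃.2⟩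
    have := hmono hηI hη'I (hη.2.trans hη'.1)
    rw [hη0, hη'0] at this
    exact lt_irrefl _ this
  rcases lt_or_gt_of_ne hne.1 with hb1 | hb1
  · exact key hb hz₁ hz₂ hb1 hlt hb0 h₁ h₂
  · rcases lt_or_gt_of_ne hne.2 with hb2 | hb2
    · exact key hz₁ hb hz₂ hb1 hb2 h₁ hb0 h₂
    · exact key hz₁ hz₂ hb hlt hb2 h₁ h₂ hb0

/-- If `φ'` is strictly monotone on `Ioo (-ρ) ρ`, `φ 0 = 0` and `φ' 0 = 0`, then `0` is the only
zero of `φ` in the interval (a double zero). [folklore] -/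
private theorem morseC2_zero_unique_of_double {φ φ' : ℝ → ℝ} {ρ : ℝ}
    (hd : ∀ b ∈ Ioo (-ρ) ρ, HasDerivAt φ (φ' b) b) (hmono : StrictMonoOn φ' (Ioo (-ρ) ρ))
    (hρ : 0 < ρ) (h0 : φ 0 = 0) (h0' : φ' 0 = 0) :
    ∀ b ∈ Ioo (-ρ) ρ, φ b = 0 → b = 0 := by
  intro b hb hb0
  have h0I : (0 : ℝ) ∈ Ioo (-ρ) ρ := ⟨by linarith, hρ⟩
  by_contra hne
  rcases lt_or_gt_of_ne hne with hlt | hlt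
  · obtain ⟨ξ, hξ, hξ0⟩ := morseC2_exists_deriv_zero hd hb h0I hlt hb0 h0
    have hξI : ξ ∈ Ioo (-ρ) ρ := ⟨hb.1.trans hξ.1, hξ.2.trans hρ⟩
    have := hmono hξI h0I hξ.2
    rw [hξ0, h0'] at this; exact lt_irrefl _ this
  · obtain ⟨ξ, hξ, hξ0⟩ := morseC2_exists_deriv_zero hd h0I hb hlt h0 hb0
    have hξI : ξ ∈ Ioo (-ρ) ρ := ⟨by linarith [hξ.1], hξ.2.trans hb.2⟩
    have := hmono h0I hξI hξ.1
    rw [hξ0, h0'] at this; exact lt_irrefl _ this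


section Setup

variable {ν : ℝ × ℝ → ℝ}

/-- A bilinear form on `ℝ × ℝ` in coordinates. [folklore] -/
private theorem bilin_prod_apply (B : ℝ × ℝ →L[ℝ] ℝ × ℝ →L[ℝ] ℝ) (u w : ℝ × ℝ) :
    B u w = u.1 * w.1 * B (1, 0) (1, 0) + u.1 * w.2 * B (1, 0) (0, 1)
      + u.2 * w.1 * B (0, 1) (1, 0) + u.2 * w.2 * B (0, 1) (0, 1) := by
  have hu : u = u.1 • ((1 : ℝ), (0 : ℝ)) + u.2 • ((0 : ℝ), (1 : ℝ)) := by ext <;> simp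
  have hw : w = w.1 • ((1 : ℝ), (0 : ℝ)) + w.2 • ((0 : ℝ), (1 : ℝ)) := by ext <;> simp
  conv_lhs => rw [hu, hw]
  simp only [map_add, map_smul, add_apply, smul_apply, smul_eq_mul]
  ring

/-- A linear functional on `ℝ × ℝ` in coordinates. [folklore] -/
private theorem lin_prod_apply (f : ℝ × ℝ →L[ℝ] ℝ) (u : ℝ × ℝ) :
    f u = u.1 * f (1, 0) + u.2 * f (0, 1) := by
  have hu : u = u.1 • ((1 : ℝ), (0 : ℝ)) + u.2 • ((0 : ℝ), (1 : ℝ)) := by ext <;> simp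
  conv_lhs => rw [hu]
  simp only [map_add, map_smul, smul_eq_mul]

/-- The Hessian of `ν` at `0` in coordinates, from the three printed normalisations and the
symmetry of second derivatives. [folklore] -/
private theorem morseC2_hess_apply (hν : ContDiff ℝ 2 ν)
    (h11 : iteratedFDeriv ℝ 2 ν 0 ![((1 : ℝ), (0 : ℝ)), ((1 : ℝ), (0 : ℝ))] = -1)
    (h12 : iteratedFDeriv ℝ 2 ν 0 ![((1 : ℝ), (0 : ℝ)), ((0 : ℝ), (1 : ℝ))] = 0)
    (h22 : iteratedFDeriv ℝ 2 ν 0 ![((0 : ℝ), (1 : ℝ)), ((0 : ℝ), (1 : ℝ))] = 1) (u w : ℝ × ℝ) :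
    fderiv ℝ (fderiv ℝ ν) 0 u w = -(u.1 * w.1) + u.2 * w.2 := by
  have hsymm : IsSymmSndFDerivAt ℝ ν 0 := hν.contDiffAt.isSymmSndFDerivAt (by simp)
  rw [iteratedFDeriv_two_apply] at h11 h12 h22
  simp only [Matrix.cons_val_zero, Matrix.cons_val_one] at h11 h12 h22
  have h21 : fderiv ℝ (fderiv ℝ ν) 0 ((0 : ℝ), (1 : ℝ)) ((1 : ℝ), (0 : ℝ)) = 0 := by
    rw [hsymm]; exact h12
  rw [bilin_prod_apply, h11, h12, h21, h22]; ring

/-- `ν ∈ C²` is differentiable. [folklore] -/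
private theorem morseC2_differentiable (hν : ContDiff ℝ 2 ν) : Differentiable ℝ ν :=
  hν.differentiable (by norm_num)

/-- `ν ∈ C²`: the derivative is `C¹`. [folklore] -/
private theorem morseC2_contDiff_fderiv (hν : ContDiff ℝ 2 ν) : ContDiff ℝ 1 (fderiv ℝ ν) :=
  hν.fderiv_right (by norm_num)

/-- The directional derivative `p ↦ Dν(p) w` is `C¹`. [folklore] -/
private theorem morseC2_contDiff_partial (hν : ContDiff ℝ 2 ν) (w : ℝ × ℝ) :
    ContDiff ℝ 1 (fun p => fderiv ℝ ν p w) :=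
  (morseC2_contDiff_fderiv hν).clm_apply contDiff_const

/-- Derivative of the directional derivative: `D(p ↦ Dν(p) w)(p) u = D²ν(p)(u)(w)`. [folklore] -/
private theorem morseC2_hasFDerivAt_partial (hν : ContDiff ℝ 2 ν) (w p : ℝ × ℝ) :
    HasFDerivAt (fun q => fderiv ℝ ν q w) ((fderiv ℝ (fderiv ℝ ν) p).flip w) p := by
  have h := ((morseC2_contDiff_fderiv hν).differentiable one_ne_zero p).hasFDerivAt.clm_apply
    (hasFDerivAt_const w p)
  simpa using h

/-- Along a ray: `t ↦ ν (t • v)` has derivative `Dν(t v) v`. [folklore] -/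
private theorem morseC2_hasDerivAt_ray (hν : ContDiff ℝ 2 ν) (v : ℝ × ℝ) (t : ℝ) :
    HasDerivAt (fun s : ℝ => ν (s • v)) (fderiv ℝ ν (t • v) v) t := by
  have h1 : HasDerivAt (fun s : ℝ => s • v) ((1 : ℝ) • v) t := (hasDerivAt_id t).smul_const v
  rw [one_smul] at h1
  exact ((morseC2_differentiable hν) (t • v)).hasFDerivAt.comp_hasDerivAt t h1

/-- Along a ray: the second derivative at `0` is `D²ν(0)(v)(v)`. [folklore] -/
private theorem morseC2_hasDerivAt_ray_deriv (hν : ContDiff ℝ 2 ν) (v : ℝ × ℝ) :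
    HasDerivAt (fun s : ℝ => fderiv ℝ ν (s • v) v) (fderiv ℝ (fderiv ℝ ν) 0 v v) 0 := by
  have h1 : HasDerivAt (fun s : ℝ => s • v) ((1 : ℝ) • v) (0 : ℝ) :=
    (hasDerivAt_id (0 : ℝ)).smul_const v
  rw [one_smul] at h1
  have h2 := morseC2_hasFDerivAt_partial hν v ((0 : ℝ) • v)
  have h3 : HasDerivAt ((fun q => fderiv ℝ ν q v) ∘ fun s : ℝ => s • v)
      (((fderiv ℝ (fderiv ℝ ν) ((0 : ℝ) • v)).flip v) v) 0 := h2.comp_hasDerivAt (0 : ℝ) h1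
  rw [zero_smul, ContinuousLinearMap.flip_apply] at h3
  exact h3

end Setup


section Hyperbolic

variable {ν : ℝ × ℝ → ℝ}

/-! ### Slices `b ↦ ν (a, b)` and the convexity box -/

/-- The slice `b ↦ ν (a, b)` has derivative `∂₂ν (a, b) = Dν(a,b) (0,1)`. [folklore] -/
private theorem morseC2_hasDerivAt_slice (hν : ContDiff ℝ 2 ν) (a b : ℝ) :
    HasDerivAt (fun b : ℝ => ν (a, b)) (fderiv ℝ ν (a, b) ((0 : ℝ), (1 : ℝ))) b := by
  have hc : HasDerivAt (fun b : ℝ => (a, b)) ((0 : ℝ), (1 : ℝ)) b :=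
    (hasDerivAt_const b a).prodMk (hasDerivAt_id b)
  exact ((morseC2_differentiable hν) (a, b)).hasFDerivAt.comp_hasDerivAt b hc

/-- The slice of `∂₂ν` has derivative `∂₂∂₂ν (a, b)`. [folklore] -/
private theorem morseC2_hasDerivAt_slice_deriv (hν : ContDiff ℝ 2 ν) (a b : ℝ) :
    HasDerivAt (fun b : ℝ => fderiv ℝ ν (a, b) ((0 : ℝ), (1 : ℝ)))
      (fderiv ℝ (fun q => fderiv ℝ ν q ((0 : ℝ), (1 : ℝ))) (a, b) ((0 : ℝ), (1 : ℝ))) b := by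
  have hc : HasDerivAt (fun b : ℝ => (a, b)) ((0 : ℝ), (1 : ℝ)) b :=
    (hasDerivAt_const b a).prodMk (hasDerivAt_id b)
  exact (((morseC2_contDiff_partial hν _).differentiable one_ne_zero) (a, b)).hasFDerivAt
    |>.comp_hasDerivAt b hc

/-- `∂₂∂₂ν (0) = D²ν(0) (0,1) (0,1)`. [folklore] -/
private theorem morseC2_fderiv_partial_apply (hν : ContDiff ℝ 2 ν) (w p u : ℝ × ℝ) :
    fderiv ℝ (fun q => fderiv ℝ ν q w) p u = fderiv ℝ (fderiv ℝ ν) p u w := by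
  rw [(morseC2_hasFDerivAt_partial hν w p).fderiv, ContinuousLinearMap.flip_apply]

/-- The convexity box: `∂₂∂₂ν ≥ 1/2` on `{|p.1| < ρ, |p.2| < ρ}` when `∂₂∂₂ν (0) = 1`
(continuity of second derivatives; [II] p.31 L16–17 "in a neighbourhood of the origin `∂₂²ν > 0`").
[cite: FeldmanSalmhoferTrubowitz1998, App. A, proof of Lemma A.1 (arXiv p.31 L16–17)] -/
theorem morseC2_exists_box (hν : ContDiff ℝ 2 ν)
    (h22' : fderiv ℝ (fderiv ℝ ν) 0 ((0 : ℝ), (1 : ℝ)) ((0 : ℝ), (1 : ℝ)) = 1) :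
    ∃ ρ : ℝ, 0 < ρ ∧ ∀ p : ℝ × ℝ, |p.1| < ρ → |p.2| < ρ →
      1 / 2 ≤ fderiv ℝ (fun q => fderiv ℝ ν q ((0 : ℝ), (1 : ℝ))) p ((0 : ℝ), (1 : ℝ)) := by
  set g : ℝ × ℝ → ℝ :=
    fun p => fderiv ℝ (fun q => fderiv ℝ ν q ((0 : ℝ), (1 : ℝ))) p ((0 : ℝ), (1 : ℝ)) with hg_def
  have hgc : Continuous g :=
    ((morseC2_contDiff_partial hν _).continuous_fderiv one_ne_zero).clm_apply continuous_const
  have hg0 : g 0 = 1 := by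
    simp only [hg_def, morseC2_fderiv_partial_apply hν, h22']
  obtain ⟨ρ, hρ, hball⟩ := Metric.continuousAt_iff.1 hgc.continuousAt (1 / 2) (by norm_num)
  refine ⟨ρ, hρ, fun p hp1 hp2 => ?_⟩
  have hdist : dist p 0 < ρ := by
    rw [dist_zero_right, Prod.norm_def, Real.norm_eq_abs, Real.norm_eq_abs]
    exact max_lt hp1 hp2
  have := hball hdist
  rw [hg0, Real.dist_eq] at this
  have := (abs_lt.1 this).1
  show 1 / 2 ≤ g p
  linarith

/-- On the box, each slice of `∂₂ν` is strictly increasing. [folklore] -/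
private theorem morseC2_strictMonoOn_slice (hν : ContDiff ℝ 2 ν) {ρ : ℝ}
    (hbox : ∀ p : ℝ × ℝ, |p.1| < ρ → |p.2| < ρ →
      1 / 2 ≤ fderiv ℝ (fun q => fderiv ℝ ν q ((0 : ℝ), (1 : ℝ))) p ((0 : ℝ), (1 : ℝ)))
    {a : ℝ} (ha : |a| < ρ) :
    StrictMonoOn (fun b : ℝ => fderiv ℝ ν (a, b) ((0 : ℝ), (1 : ℝ))) (Ioo (-ρ) ρ) := by
  refine strictMonoOn_of_deriv_pos (convex_Ioo _ _)
    (fun b _ => (morseC2_hasDerivAt_slice_deriv hν a b).continuousAt.continuousWithinAt) ?_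
  intro b hb
  rw [interior_Ioo] at hb
  rw [(morseC2_hasDerivAt_slice_deriv hν a b).deriv]
  have := hbox (a, b) ha (abs_lt.2 hb)
  linarith

/-! ### Signs along rays through the critical point -/

/-- Along the ray `a ↦ (a, s a)`: `ν (a, s a) > 0` for small `a ≠ 0` when `s² > 1`
(`D²ν(0)(1,s)(1,s) = s² - 1`): the second-order representation (R1) of [II] p.30 L109–134,
"`ν = -½αφ₁² + βφ₁φ₂ + ½γφ₂²`, `α, γ = 1 + o(1)`, `β = o(1)`", read on a ray (here via the
one-dimensional `C²` sign lemma).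
[cite: FeldmanSalmhoferTrubowitz1998, App. A eq. (R1) (arXiv p.30 L109–134)] -/
theorem morseC2_ray_pos (hν : ContDiff ℝ 2 ν) (h0 : ν 0 = 0) (h1 : fderiv ℝ ν 0 = 0)
    (hess : ∀ u w : ℝ × ℝ, fderiv ℝ (fderiv ℝ ν) 0 u w = -(u.1 * w.1) + u.2 * w.2)
    {s : ℝ} (hs : 1 < s ^ 2) : ∀ᶠ a in 𝓝[≠] 0, 0 < ν (a, s * a) := by
  set v : ℝ × ℝ := ((1 : ℝ), s)
  have hray : ∀ a : ℝ, a • v = (a, s * a) := fun a => by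
    ext <;> simp [v, mul_comm]
  have h := morseC2_eventually_pos_of_deriv2_pos (f := fun a : ℝ => ν (a • v))
    (f' := fun a : ℝ => fderiv ℝ ν (a • v) v) (c := -((1 : ℝ) * 1) + s * s)
    (by simp [h0]) (Eventually.of_forall (morseC2_hasDerivAt_ray hν v)) (by simp [h1])
    (by simpa [hess, v] using morseC2_hasDerivAt_ray_deriv hν v) (by nlinarith)
  exact h.mono fun a ha => by rwa [hray] at ha

/-- Along the ray `a ↦ (a, s a)`: `ν (a, s a) < 0` for small `a ≠ 0` when `s² < 1` ((R1) of
[II] p.30 L109–134 read on a ray). [cite: FeldmanSalmhoferTrubowitz1998, App. A eq. (R1) (arXiv p.30 L109–134)] -/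
theorem morseC2_ray_neg (hν : ContDiff ℝ 2 ν) (h0 : ν 0 = 0) (h1 : fderiv ℝ ν 0 = 0)
    (hess : ∀ u w : ℝ × ℝ, fderiv ℝ (fderiv ℝ ν) 0 u w = -(u.1 * w.1) + u.2 * w.2)
    {s : ℝ} (hs : s ^ 2 < 1) : ∀ᶠ a in 𝓝[≠] 0, ν (a, s * a) < 0 := by
  set v : ℝ × ℝ := ((1 : ℝ), s)
  have hray : ∀ a : ℝ, a • v = (a, s * a) := fun a => by
    ext <;> simp [v, mul_comm]
  have h := morseC2_eventually_neg_of_deriv2_neg (f := fun a : ℝ => ν (a • v))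
    (f' := fun a : ℝ => fderiv ℝ ν (a • v) v) (c := -((1 : ℝ) * 1) + s * s)
    (by simp [h0]) (Eventually.of_forall (morseC2_hasDerivAt_ray hν v)) (by simp [h1])
    (by simpa [hess, v] using morseC2_hasDerivAt_ray_deriv hν v) (by nlinarith)
  exact h.mono fun a ha => by rwa [hray] at ha

/-! ### The two zeros of each slice, `a ≠ 0` small -/

/-- For `a ≠ 0` small, the slice `b ↦ ν (a, b)` has a zero in `(0, 2|a|)` and a zero in
`(-2|a|, 0)` ([II] p.31 L12–21: "`ν(φ₁, φ₂)` necessarily changes sign … so it has exactly two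
zeroes"). [cite: FeldmanSalmhoferTrubowitz1998, App. A, proof of Lemma A.1 (arXiv p.31 L12–21)] -/
theorem morseC2_exists_zeros (hν : ContDiff ℝ 2 ν) (h0 : ν 0 = 0) (h1 : fderiv ℝ ν 0 = 0)
    (hess : ∀ u w : ℝ × ℝ, fderiv ℝ (fderiv ℝ ν) 0 u w = -(u.1 * w.1) + u.2 * w.2)
    {ρ : ℝ} (hρ : 0 < ρ) :
    ∃ δ : ℝ, 0 < δ ∧ 2 * δ ≤ ρ ∧ ∀ a : ℝ, a ≠ 0 → |a| < δ →
      ν (a, 0) < 0 ∧ (∃ b ∈ Ioo 0 (2 * |a|), ν (a, b) = 0) ∧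
        (∃ b ∈ Ioo (-(2 * |a|)) 0, ν (a, b) = 0) := by
  have E1 := morseC2_ray_neg hν h0 h1 hess (s := 0) (by norm_num)
  have E2 := morseC2_ray_pos hν h0 h1 hess (s := 2) (by norm_num)
  have E3 := morseC2_ray_pos hν h0 h1 hess (s := -2) (by norm_num)
  have E := (E1.and (E2.and E3))
  rw [eventually_nhdsWithin_iff, Metric.eventually_nhds_iff] at E
  obtain ⟨ε, hε, hE⟩ := E
  refine ⟨min ε (ρ / 2), lt_min hε (by linarith), by linarith [min_le_right ε (ρ / 2)],
    fun a ha0 ha => ?_⟩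
  have haε : dist a 0 < ε := by
    rw [dist_zero_right, Real.norm_eq_abs]; exact ha.trans_le (min_le_left _ _)
  obtain ⟨hz, hp2, hm2⟩ := hE haε ha0
  simp only [zero_mul] at hz
  -- the values at `± 2|a|` are positive
  have hP : 0 < ν (a, 2 * |a|) ∧ 0 < ν (a, -(2 * |a|)) := by
    rcases lt_or_gt_of_ne ha0 with hneg | hpos
    · rw [abs_of_neg hneg]
      refine ⟨by convert hm2 using 3; ring, by convert hp2 using 3; ring⟩
    · rw [abs_of_pos hpos]
      refine ⟨hp2, by convert hm2 using 3; ring⟩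
  have hcont : Continuous fun b : ℝ => ν (a, b) :=
    continuous_iff_continuousAt.2 fun b => (morseC2_hasDerivAt_slice hν a b).continuousAt
  have h2a : 0 < 2 * |a| := by positivity
  refine ⟨hz, ?_, ?_⟩
  · have := intermediate_value_Ioo h2a.le hcont.continuousOn (f := fun b : ℝ => ν (a, b))
    obtain ⟨b, hb, hb0⟩ := this (show (0 : ℝ) ∈ Ioo (ν (a, 0)) (ν (a, 2 * |a|)) from ⟨hz, hP.1⟩)
    exact ⟨b, hb, hb0⟩
  · have := intermediate_value_Ioo' (neg_lt_zero.2 h2a).le hcont.continuousOn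
      (f := fun b : ℝ => ν (a, b))
    obtain ⟨b, hb, hb0⟩ :=
      this (show (0 : ℝ) ∈ Ioo (ν (a, 0)) (ν (a, -(2 * |a|))) from ⟨hz, hP.2⟩)
    exact ⟨b, hb, hb0⟩

end Hyperbolic

section Transfer

variable {ν : ℝ × ℝ → ℝ}

/-- The map `t ↦ Dν(u) (0, t)` is invertible when `∂₂ν (u) ≠ 0`. [folklore] -/
private theorem morseC2_isInvertible_inr (L : ℝ × ℝ →L[ℝ] ℝ) (hL : L ((0 : ℝ), (1 : ℝ)) ≠ 0) :
    (L ∘L ContinuousLinearMap.inr ℝ ℝ ℝ).IsInvertible := by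
  set c : ℝ := L ((0 : ℝ), (1 : ℝ)) with hc
  have happly : ∀ t : ℝ, (L ∘L ContinuousLinearMap.inr ℝ ℝ ℝ) t = t * c := by
    intro t
    rw [ContinuousLinearMap.comp_apply, ContinuousLinearMap.inr_apply, lin_prod_apply]
    simp [hc]
  refine ContinuousLinearMap.IsInvertible.of_inverse (g := c⁻¹ • ContinuousLinearMap.id ℝ ℝ)
    ?_ ?_
  · ext
    simp only [ContinuousLinearMap.comp_apply, smul_apply, ContinuousLinearMap.id_apply,
      smul_eq_mul, happly]
    field_simp
  · ext
    simp only [ContinuousLinearMap.comp_apply, smul_apply, ContinuousLinearMap.id_apply,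
      smul_eq_mul, happly]
    field_simp

/-- **Transfer from the implicit function theorem.** If `ν ∈ C²` vanishes at `(a₀, ψ a₀)` with
`∂₂ν ≠ 0` there, and near `a₀` the value `ψ a` is the ONLY zero of `ν (a, ·)` in a fixed
neighbourhood `V` of `ψ a₀`, then `ψ` is `C²` at `a₀`, `ν (a, ψ a) = 0` near `a₀`, and
`ψ' (a₀) = -∂₁ν/∂₂ν` ([II] p.31 L46–56: "`ψ'_± = -∂₁ν/∂₂ν` … hence `ψ_±` is `C¹` away from
`φ₁ = 0`"). The implicit function is Mathlib's `ContDiffAt.implicitFunction`.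
[cite: FeldmanSalmhoferTrubowitz1998, App. A, proof of Lemma A.1 (arXiv p.31 L46–56)] -/
theorem morseC2_contDiffAt_of_unique_zero (hν : ContDiff ℝ 2 ν) (ψ : ℝ → ℝ) (a₀ : ℝ)
    (hz : ν (a₀, ψ a₀) = 0) (hT : fderiv ℝ ν (a₀, ψ a₀) ((0 : ℝ), (1 : ℝ)) ≠ 0) {V : Set ℝ}
    (hV : V ∈ 𝓝 (ψ a₀)) (hU : ∀ᶠ a in 𝓝 a₀, ∀ b ∈ V, ν (a, b) = 0 → b = ψ a) :
    ContDiffAt ℝ 2 ψ a₀ ∧ (∀ᶠ a in 𝓝 a₀, ν (a, ψ a) = 0) ∧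
      deriv ψ a₀ = -(fderiv ℝ ν (a₀, ψ a₀) ((1 : ℝ), (0 : ℝ))) /
        fderiv ℝ ν (a₀, ψ a₀) ((0 : ℝ), (1 : ℝ)) := by
  set u : ℝ × ℝ := (a₀, ψ a₀) with hu
  have hcd : ContDiffAt ℝ 2 ν u := hν.contDiffAt
  have hinv := morseC2_isInvertible_inr (fderiv ℝ ν u) hT
  set χ : ℝ → ℝ := hcd.implicitFunction two_ne_zero hinv with hχ
  have hχu : χ a₀ = ψ a₀ := hcd.implicitFunction_apply_self two_ne_zero hinv
  have hχC : ContDiffAt ℝ 2 χ a₀ := hcd.contDiffAt_implicitFunction two_ne_zero hinv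
  have hχeq : ∀ᶠ q in 𝓝 u, ν q = ν u ↔ χ q.1 = q.2 :=
    hcd.eventually_apply_eq_iff_implicitFunction two_ne_zero hinv
  have hχcont : ContinuousAt χ a₀ := hχC.continuousAt
  have hcurve : Tendsto (fun a : ℝ => (a, χ a)) (𝓝 a₀) (𝓝 u) := by
    have : u = (a₀, χ a₀) := by rw [hχu]
    rw [this]
    exact (continuous_id.tendsto a₀).prodMk_nhds hχcont
  have hzeroχ : ∀ᶠ a in 𝓝 a₀, ν (a, χ a) = 0 := by
    filter_upwards [hcurve.eventually hχeq] with a ha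
    have : ν (a, χ a) = ν u := ha.2 rfl
    rw [this]; exact hz
  have hχV : ∀ᶠ a in 𝓝 a₀, χ a ∈ V := hχcont.preimage_mem_nhds (by rw [hχu]; exact hV)
  have hEq : ∀ᶠ a in 𝓝 a₀, ψ a = χ a := by
    filter_upwards [hzeroχ, hχV, hU] with a h1 h2 h3
    exact (h3 (χ a) h2 h1).symm
  have hψC : ContDiffAt ℝ 2 ψ a₀ := hχC.congr_of_eventuallyEq hEq
  have hzeroψ : ∀ᶠ a in 𝓝 a₀, ν (a, ψ a) = 0 := by
    filter_upwards [hzeroχ, hEq] with a h1 h2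
    rw [h2]; exact h1
  refine ⟨hψC, hzeroψ, ?_⟩
  -- the derivative formula, by differentiating `ν (a, ψ a) = 0`
  have hψd : HasDerivAt ψ (deriv ψ a₀) a₀ := (hψC.differentiableAt (by norm_num)).hasDerivAt
  have hcomp : HasDerivAt (fun a : ℝ => ν (a, ψ a)) (fderiv ℝ ν u ((1 : ℝ), deriv ψ a₀)) a₀ :=
    ((morseC2_differentiable hν) u).hasFDerivAt.comp_hasDerivAt a₀
      ((hasDerivAt_id a₀).prodMk hψd)
  have hzero' : HasDerivAt (fun a : ℝ => ν (a, ψ a)) 0 a₀ :=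
    (hasDerivAt_const a₀ (0 : ℝ)).congr_of_eventuallyEq hzeroψ
  have hlin := hcomp.unique hzero'
  rw [lin_prod_apply] at hlin
  simp only at hlin
  field_simp
  linarith

/-- **`C¹` at the critical abscissa.** A function with a derivative `d` at `0`, `C¹` on a
punctured neighbourhood of `0`, whose derivative tends to `d` at `0`, is `C¹` at `0` — the step
[II] p.31 L56–57 "Hence `ψ_±` is `C¹` away from `φ₁ = 0`. It only remains to verify the
continuity of `ψ'_±` at `φ₁ = 0`" as a one-dimensional statement.
[cite: FeldmanSalmhoferTrubowitz1998, App. A, proof of Lemma A.1 (arXiv p.31 L56–57)] -/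
theorem morseC2_contDiffAt_one_of_punctured {ψ : ℝ → ℝ} {d : ℝ} (hd : HasDerivAt ψ d 0)
    (hC : ∀ᶠ a in 𝓝[≠] 0, ContDiffAt ℝ 1 ψ a)
    (hlim : Tendsto (deriv ψ) (𝓝[≠] 0) (𝓝 d)) : ContDiffAt ℝ 1 ψ 0 := by
  rw [eventually_nhdsWithin_iff, Metric.eventually_nhds_iff] at hC
  obtain ⟨ε, hε, hC⟩ := hC
  have hCa : ∀ a : ℝ, a ≠ 0 → |a| < ε → ContDiffAt ℝ 1 ψ a := fun a ha0 ha =>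
    hC (by rwa [dist_zero_right, Real.norm_eq_abs]) ha0
  set s : Set ℝ := Ioo (-ε) ε
  have hs : IsOpen s := isOpen_Ioo
  have hmem : ∀ a ∈ s, |a| < ε := fun a ha => abs_lt.2 ha
  have hdiff : DifferentiableOn ℝ ψ s := by
    intro a ha
    by_cases ha0 : a = 0
    · rw [ha0]; exact hd.differentiableAt.differentiableWithinAt
    · exact ((hCa a ha0 (hmem a ha)).differentiableAt one_ne_zero).differentiableWithinAt
  have hcont : ContinuousOn (deriv ψ) s := by
    intro a ha
    by_cases ha0 : a = 0
    · subst ha0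
      have h0 : ContinuousAt (deriv ψ) 0 := by
        rw [← continuousWithinAt_compl_self, ContinuousWithinAt, hd.deriv]
        exact hlim
      exact h0.continuousWithinAt
    · have h1 : ContDiffAt ℝ 0 (fderiv ℝ ψ) a := (hCa a ha0 (hmem a ha)).fderiv_right le_rfl
      have h2 : ContinuousAt (fun x => fderiv ℝ ψ x 1) a :=
        h1.continuousAt.clm_apply continuousAt_const
      have h3 : (fun x => fderiv ℝ ψ x 1) = deriv ψ := funext fun x => fderiv_apply_one_eq_deriv
      rw [h3] at h2
      exact h2.continuousWithinAt
  have hOn : ContDiffOn ℝ 1 ψ s := by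
    rw [show (1 : WithTop ℕ∞) = 0 + 1 from rfl, contDiffOn_succ_iff_deriv_of_isOpen hs]
    exact ⟨hdiff, fun h => absurd h (by simp), contDiffOn_zero.2 hcont⟩
  exact hOn.contDiffAt (Ioo_mem_nhds (by linarith) hε)

/-- **The limit of `-∂₁ν/∂₂ν` along a branch.** If `ψ a / a → 1` as `a → 0` (`a ≠ 0`), then
`-∂₁ν (a, ψ a) / ∂₂ν (a, ψ a) → 1` ([II] p.31 L58–71: the `o(1)` computation
"`ψ'_± = -(-[1+o(1)]φ₁ ± o(1)Ψ φ₁)/(o(1)φ₁ ± [1+o(1)]Ψ φ₁) = ±1 + o(1)`"), from the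
differentiability of `∂₁ν, ∂₂ν` at `0` with `D(∂₁ν)(0) = (h,k) ↦ -h`, `D(∂₂ν)(0) = (h,k) ↦ k`.
[cite: FeldmanSalmhoferTrubowitz1998, App. A, proof of Lemma A.1 (arXiv p.31 L58–71)] -/
theorem morseC2_tendsto_quotient (hν : ContDiff ℝ 2 ν) (h1 : fderiv ℝ ν 0 = 0)
    (hess : ∀ u w : ℝ × ℝ, fderiv ℝ (fderiv ℝ ν) 0 u w = -(u.1 * w.1) + u.2 * w.2)
    {ψ : ℝ → ℝ} {σ : ℝ} (hσ : σ = 1 ∨ σ = -1) (hψ0 : Tendsto ψ (𝓝[≠] 0) (𝓝 0))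
    (hslope : Tendsto (fun a => ψ a / a) (𝓝[≠] 0) (𝓝 σ)) :
    Tendsto (fun a => -(fderiv ℝ ν (a, ψ a) ((1 : ℝ), (0 : ℝ))) /
      fderiv ℝ ν (a, ψ a) ((0 : ℝ), (1 : ℝ))) (𝓝[≠] 0) (𝓝 σ) := by
  -- the path `P a = (a, ψ a)` tends to `0` and is `O(a)`
  set P : ℝ → ℝ × ℝ := fun a => (a, ψ a) with hP
  have hPt : Tendsto P (𝓝[≠] 0) (𝓝 0) :=
    (tendsto_id.mono_left nhdsWithin_le_nhds).prodMk_nhds hψ0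
  have hbdd : ∀ᶠ a in 𝓝[≠] (0 : ℝ), |ψ a / a| < 2 := by
    have : ∀ᶠ a in 𝓝[≠] (0 : ℝ), dist (ψ a / a) σ < 1 := Metric.tendsto_nhds.1 hslope 1 one_pos
    filter_upwards [this] with a ha
    rw [Real.dist_eq] at ha
    rcases hσ with h | h <;> rw [h] at ha <;>
      [have := abs_lt.1 ha; have := abs_lt.1 ha] <;> rw [abs_lt] <;> constructor <;> linarith
  have hPO : (fun a => P a - 0) =O[𝓝[≠] 0] fun a => a := by
    refine IsBigO.of_bound 2 ?_
    filter_upwards [hbdd, self_mem_nhdsWithin] with a ha ha0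
    replace ha0 : a ≠ 0 := ha0
    simp only [hP, sub_zero, Prod.norm_def, Real.norm_eq_abs]
    have ha0' : 0 < |a| := abs_pos.2 ha0
    have : |ψ a| < 2 * |a| := by
      rw [abs_div] at ha
      rwa [div_lt_iff₀ ha0'] at ha
    exact max_le (by linarith) this.le
  -- little-o expansions of the two partial derivatives along the path
  have key : ∀ w : ℝ × ℝ, Tendsto (fun a => (fderiv ℝ ν (P a) w -
      fderiv ℝ (fderiv ℝ ν) 0 (P a) w) / a) (𝓝[≠] 0) (𝓝 0) := by
    intro w
    have hG := (morseC2_hasFDerivAt_partial hν w 0).isLittleO.comp_tendsto hPt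
    have hG' := hG.trans_isBigO hPO
    have := hG'.tendsto_div_nhds_zero
    refine this.congr' ?_
    filter_upwards with a
    simp [Function.comp, hP, h1, ContinuousLinearMap.flip_apply]
  have k1 := key ((1 : ℝ), (0 : ℝ))
  have k2 := key ((0 : ℝ), (1 : ℝ))
  simp only [hess, hP] at k1 k2
  -- `∂₁ν(P a)/a → -1` and `∂₂ν(P a)/a → σ`
  have l1 : Tendsto (fun a => fderiv ℝ ν (a, ψ a) ((1 : ℝ), (0 : ℝ)) / a) (𝓝[≠] 0) (𝓝 (-1)) := by
    have h := k1.add (tendsto_const_nhds (x := (-1 : ℝ)))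
    rw [zero_add] at h
    refine h.congr' ?_
    filter_upwards [self_mem_nhdsWithin] with a ha
    replace ha : a ≠ 0 := ha
    simp only [mul_one, mul_zero, add_zero, sub_neg_eq_add]
    rw [add_div, div_self ha]
    ring
  have l2 : Tendsto (fun a => fderiv ℝ ν (a, ψ a) ((0 : ℝ), (1 : ℝ)) / a) (𝓝[≠] 0) (𝓝 σ) := by
    have h := k2.add hslope
    rw [zero_add] at h
    refine h.congr' ?_
    filter_upwards [self_mem_nhdsWithin] with a ha
    simp only [mul_one, mul_zero, neg_zero, zero_add]
    rw [sub_div]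
    ring
  have l3 := (l1.neg).div l2 (by rcases hσ with h | h <;> rw [h] <;> norm_num)
  have hlim : -(-1 : ℝ) / σ = σ := by rcases hσ with h | h <;> rw [h] <;> norm_num
  rw [hlim] at l3
  refine l3.congr' ?_
  filter_upwards [self_mem_nhdsWithin] with a ha
  replace ha : a ≠ 0 := ha
  simp only [Pi.div_apply]
  rw [← neg_div, div_div_div_cancel_right₀ ha]

end Transfer

section PosBranch

variable {ν : ℝ × ℝ → ℝ}

/-- **The positive branch** (the `ψ₊` of [II] Lemma A.1, p.30 L69–90, with the facts its proof
establishes, p.30 L176–p.31 L71): for `ν ∈ C²` with `ν(0) = 0`, `Dν(0) = 0`,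
`D²ν(0) = diag(-1, 1)` there is `ψ : ℝ → ℝ`, `C¹` at `0` and `C²` on a punctured neighbourhood,
with `ψ 0 = 0`, `ψ' (0) = 1`, `ν (a, ψ a) = 0` near `0`, `0 < ψ a / a < 2` and
`∂₂ν (a, ψ a) ≠ 0`, `ψ' (a) = -∂₁ν/∂₂ν (a, ψ a)` for small `a ≠ 0`.
[cite: FeldmanSalmhoferTrubowitz1998, App. A Lemma A.1 (arXiv p.30 L69–90, proof p.30 L176–p.31 L71)] -/
theorem morseC2_exists_posBranch (hν : ContDiff ℝ 2 ν) (h0 : ν 0 = 0) (h1 : fderiv ℝ ν 0 = 0)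
    (hess : ∀ u w : ℝ × ℝ, fderiv ℝ (fderiv ℝ ν) 0 u w = -(u.1 * w.1) + u.2 * w.2) :
    ∃ ψ : ℝ → ℝ, ψ 0 = 0 ∧ HasDerivAt ψ 1 0 ∧ ContDiffAt ℝ 1 ψ 0 ∧
      (∀ᶠ a in 𝓝 0, ν (a, ψ a) = 0) ∧
      ∀ᶠ a in 𝓝[≠] 0, 0 < ψ a / a ∧ ψ a / a < 2 ∧ ContDiffAt ℝ 2 ψ a ∧
        fderiv ℝ ν (a, ψ a) ((0 : ℝ), (1 : ℝ)) ≠ 0 ∧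
        deriv ψ a = -(fderiv ℝ ν (a, ψ a) ((1 : ℝ), (0 : ℝ))) /
          fderiv ℝ ν (a, ψ a) ((0 : ℝ), (1 : ℝ)) := by
  -- Step 1: the convexity box and the two zeros of each slice
  have h22' : fderiv ℝ (fderiv ℝ ν) 0 ((0 : ℝ), (1 : ℝ)) ((0 : ℝ), (1 : ℝ)) = 1 := by
    rw [hess]; norm_num
  obtain ⟨ρ, hρ, hbox⟩ := morseC2_exists_box hν h22'
  obtain ⟨δ, hδ, hδρ, hzeros⟩ := morseC2_exists_zeros hν h0 h1 hess hρ
  have hbp' : ∀ a : ℝ, ∃ b : ℝ, (a ≠ 0 ∧ |a| < δ) → b ∈ Ioo 0 (2 * |a|) ∧ ν (a, b) = 0 := by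
    intro a
    by_cases h : a ≠ 0 ∧ |a| < δ
    · obtain ⟨b, hb, hb0⟩ := (hzeros a h.1 h.2).2.1
      exact ⟨b, fun _ => ⟨hb, hb0⟩⟩
    · exact ⟨0, fun h' => absurd h' h⟩
  choose bp hbp using hbp'
  have hbn' : ∀ a : ℝ, ∃ b : ℝ, (a ≠ 0 ∧ |a| < δ) →
      b ∈ Ioo (-(2 * |a|)) 0 ∧ ν (a, b) = 0 := by
    intro a
    by_cases h : a ≠ 0 ∧ |a| < δ
    · obtain ⟨b, hb, hb0⟩ := (hzeros a h.1 h.2).2.2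
      exact ⟨b, fun _ => ⟨hb, hb0⟩⟩
    · exact ⟨0, fun h' => absurd h' h⟩
  choose bn hbn using hbn'
  -- Step 2: the slice structure for `0 < |a| < δ`: exactly the zeros `bn a < 0 < bp a`
  have hstruct : ∀ a : ℝ, a ≠ 0 → |a| < δ →
      (fderiv ℝ ν (a, bn a) ((0 : ℝ), (1 : ℝ)) < 0 ∧
        0 < fderiv ℝ ν (a, bp a) ((0 : ℝ), (1 : ℝ))) ∧
      ∀ b ∈ Ioo (-ρ) ρ, ν (a, b) = 0 → b = bn a ∨ b = bp a := by
    intro a ha0 ha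
    obtain ⟨hbnI, hbn0⟩ := hbn a ⟨ha0, ha⟩
    obtain ⟨hbpI, hbp0⟩ := hbp a ⟨ha0, ha⟩
    have h2a : 2 * |a| < ρ := by linarith
    exact morseC2_zeros_of_strictMonoOn_deriv (φ := fun b => ν (a, b))
      (φ' := fun b => fderiv ℝ ν (a, b) ((0 : ℝ), (1 : ℝ)))
      (fun b _ => morseC2_hasDerivAt_slice hν a b)
      (morseC2_strictMonoOn_slice hν hbox (by linarith [abs_nonneg a]))
      ⟨by linarith [hbnI.1], by linarith [hbnI.2]⟩ ⟨by linarith [hbpI.1], by linarith [hbpI.2]⟩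
      (hbnI.2.trans hbpI.1) hbn0 hbp0
  -- Step 3: the branch with the sign of `a`
  obtain ⟨ψ, hψdef⟩ : ∃ ψ : ℝ → ℝ,
      ψ = fun a => if 0 < a then bp a else if a < 0 then bn a else 0 := ⟨_, rfl⟩
  have hψp : ∀ a, 0 < a → ψ a = bp a := fun a ha => by simp [hψdef, ha]
  have hψn : ∀ a, a < 0 → ψ a = bn a := fun a ha => by simp [hψdef, ha, not_lt.2 ha.le]
  have hψ0 : ψ 0 = 0 := by simp [hψdef]
  have hgood : ∀ a : ℝ, a ≠ 0 → |a| < δ →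
      ν (a, ψ a) = 0 ∧ 0 < ψ a / a ∧ ψ a / a < 2 ∧ ψ a ∈ Ioo (-ρ) ρ ∧
        fderiv ℝ ν (a, ψ a) ((0 : ℝ), (1 : ℝ)) ≠ 0 := by
    intro a ha0 ha
    have h2a : 2 * |a| < ρ := by linarith
    obtain ⟨⟨hTn, hTp⟩, -⟩ := hstruct a ha0 ha
    rcases lt_or_gt_of_ne ha0 with hneg | hpos
    · obtain ⟨hbI, hb0⟩ := hbn a ⟨ha0, ha⟩
      rw [abs_of_neg hneg] at hbI h2a
      rw [hψn a hneg]
      refine ⟨hb0, div_pos_of_neg_of_neg hbI.2 hneg, ?_, ⟨?_, ?_⟩, hTn.ne⟩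
      · rw [div_lt_iff_of_neg hneg]; linarith [hbI.1]
      · linarith [hbI.1]
      · linarith [hbI.2]
    · obtain ⟨hbI, hb0⟩ := hbp a ⟨ha0, ha⟩
      rw [abs_of_pos hpos] at hbI h2a
      rw [hψp a hpos]
      refine ⟨hb0, div_pos hbI.1 hpos, ?_, ⟨?_, ?_⟩, hTp.ne'⟩
      · rw [div_lt_iff₀ hpos]; linarith [hbI.2]
      · linarith [hbI.1]
      · linarith [hbI.2]
  have hδn : ∀ᶠ a in 𝓝 (0 : ℝ), |a| < δ :=
    Metric.eventually_nhds_iff.2 ⟨δ, hδ, fun a ha => by simpa [Real.dist_eq] using ha⟩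
  have hev : ∀ᶠ a in 𝓝[≠] (0 : ℝ), a ≠ 0 ∧ |a| < δ :=
    ((hδn.filter_mono nhdsWithin_le_nhds).and self_mem_nhdsWithin).mono
      fun a h => ⟨h.2, h.1⟩
  -- Step 4: localisation between the rays `(1 ± ε) a`, hence `ψ a / a → 1`
  have hloc : ∀ ε : ℝ, 0 < ε → ε < 1 → ∀ᶠ a in 𝓝[≠] (0 : ℝ), |ψ a / a - 1| < ε := by
    intro ε hε hε1
    have R1 := morseC2_ray_neg hν h0 h1 hess (s := 1 - ε) (by nlinarith)
    have R2 := morseC2_ray_pos hν h0 h1 hess (s := 1 + ε) (by nlinarith)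
    filter_upwards [R1, R2, hev] with a hR1 hR2 ⟨ha0, ha⟩
    have hcont : Continuous fun b : ℝ => ν (a, b) :=
      continuous_iff_continuousAt.2 fun b => (morseC2_hasDerivAt_slice hν a b).continuousAt
    have h2a : 2 * |a| < ρ := by linarith
    obtain ⟨-, huniq⟩ := hstruct a ha0 ha
    rcases lt_or_gt_of_ne ha0 with hneg | hpos
    · have hlt : (1 + ε) * a < (1 - ε) * a := by nlinarith
      obtain ⟨z, hz, hz0⟩ : ∃ z ∈ Ioo ((1 + ε) * a) ((1 - ε) * a), ν (a, z) = 0 :=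
        intermediate_value_Ioo' hlt.le hcont.continuousOn ⟨hR1, hR2⟩
      rw [abs_of_neg hneg] at h2a
      have hzI : z ∈ Ioo (-ρ) ρ := ⟨by nlinarith [hz.1], by nlinarith [hz.2]⟩
      rcases huniq z hzI hz0 with h | h
      · rw [hψn a hneg, ← h, abs_lt]
        constructor
        · have : 1 - ε < z / a := by rw [lt_div_iff_of_neg hneg]; linarith [hz.2]
          linarith
        · have : z / a < 1 + ε := by rw [div_lt_iff_of_neg hneg]; linarith [hz.1]
          linarith
      · exfalso
        have := (hbp a ⟨ha0, ha⟩).1.1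
        rw [← h] at this; nlinarith [hz.2]
    · have hlt : (1 - ε) * a < (1 + ε) * a := by nlinarith
      obtain ⟨z, hz, hz0⟩ : ∃ z ∈ Ioo ((1 - ε) * a) ((1 + ε) * a), ν (a, z) = 0 :=
        intermediate_value_Ioo hlt.le hcont.continuousOn ⟨hR1, hR2⟩
      rw [abs_of_pos hpos] at h2a
      have hzI : z ∈ Ioo (-ρ) ρ := ⟨by nlinarith [hz.1], by nlinarith [hz.2]⟩
      rcases huniq z hzI hz0 with h | h
      · exfalso
        have := (hbn a ⟨ha0, ha⟩).1.2
        rw [← h] at this; nlinarith [hz.1]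
      · rw [hψp a hpos, ← h, abs_lt]
        constructor
        · have : 1 - ε < z / a := by rw [lt_div_iff₀ hpos]; linarith [hz.1]
          linarith
        · have : z / a < 1 + ε := by rw [div_lt_iff₀ hpos]; linarith [hz.2]
          linarith
  have hslope : Tendsto (fun a => ψ a / a) (𝓝[≠] 0) (𝓝 1) := by
    refine Metric.tendsto_nhds.2 fun ε hε => ?_
    have := hloc (min ε (1 / 2)) (lt_min hε (by norm_num))
      (by linarith [min_le_right ε (1 / 2)])
    filter_upwards [this] with a ha
    rw [Real.dist_eq]
    exact ha.trans_le (min_le_left _ _)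
  -- Step 5: derivative `1` at `0`, continuity at `0`
  have hderiv0 : HasDerivAt ψ 1 0 := by
    rw [hasDerivAt_iff_tendsto_slope, slope_fun_def_field]
    simp only [hψ0, sub_zero]
    exact hslope
  have hψt : Tendsto ψ (𝓝[≠] 0) (𝓝 0) := by
    have := hderiv0.continuousAt.tendsto
    rw [hψ0] at this
    exact this.mono_left nhdsWithin_le_nhds
  -- Step 6: `C²` off `0` by the implicit function theorem, with the derivative formula
  have hIFT : ∀ a : ℝ, a ≠ 0 → |a| < δ → ContDiffAt ℝ 2 ψ a ∧
      deriv ψ a = -(fderiv ℝ ν (a, ψ a) ((1 : ℝ), (0 : ℝ))) /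
        fderiv ℝ ν (a, ψ a) ((0 : ℝ), (1 : ℝ)) := by
    intro a₀ ha₀ ha₀δ
    obtain ⟨hz, -, -, hI, hT⟩ := hgood a₀ ha₀ ha₀δ
    have hlo : -δ < a₀ := (abs_lt.1 ha₀δ).1
    have hhi : a₀ < δ := (abs_lt.1 ha₀δ).2
    rcases lt_or_gt_of_ne ha₀ with hneg | hpos
    · have hψlt : ψ a₀ < 0 := by rw [hψn a₀ hneg]; exact (hbn a₀ ⟨ha₀, ha₀δ⟩).1.2
      have hV : Ioo (-ρ) 0 ∈ 𝓝 (ψ a₀) := Ioo_mem_nhds hI.1 hψlt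
      have hU : ∀ᶠ a in 𝓝 a₀, ∀ b ∈ Ioo (-ρ) 0, ν (a, b) = 0 → b = ψ a := by
        filter_upwards [Iio_mem_nhds hneg, Ioo_mem_nhds hlo hhi] with a ha haI b hb hb0
        have ha0 : a ≠ 0 := ne_of_lt ha
        have haδ : |a| < δ := abs_lt.2 haI
        rcases (hstruct a ha0 haδ).2 b ⟨hb.1, hb.2.trans hρ⟩ hb0 with h | h
        · rw [h, hψn a ha]
        · exfalso
          have := (hbp a ⟨ha0, haδ⟩).1.1
          rw [← h] at this; linarith [hb.2]
      have := morseC2_contDiffAt_of_unique_zero hν ψ a₀ hz hT hV hU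
      exact ⟨this.1, this.2.2⟩
    · have hψgt : 0 < ψ a₀ := by rw [hψp a₀ hpos]; exact (hbp a₀ ⟨ha₀, ha₀δ⟩).1.1
      have hV : Ioo 0 ρ ∈ 𝓝 (ψ a₀) := Ioo_mem_nhds hψgt hI.2
      have hU : ∀ᶠ a in 𝓝 a₀, ∀ b ∈ Ioo 0 ρ, ν (a, b) = 0 → b = ψ a := by
        filter_upwards [Ioi_mem_nhds hpos, Ioo_mem_nhds hlo hhi] with a ha haI b hb hb0
        have ha0 : a ≠ 0 := ne_of_gt ha
        have haδ : |a| < δ := abs_lt.2 haI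
        rcases (hstruct a ha0 haδ).2 b ⟨by linarith [hb.1], hb.2⟩ hb0 with h | h
        · exfalso
          have := (hbn a ⟨ha0, haδ⟩).1.2
          rw [← h] at this; linarith [hb.1]
        · rw [h, hψp a ha]
      have := morseC2_contDiffAt_of_unique_zero hν ψ a₀ hz hT hV hU
      exact ⟨this.1, this.2.2⟩
  -- Step 7: `C¹` at `0`
  have hevC : ∀ᶠ a in 𝓝[≠] (0 : ℝ), ContDiffAt ℝ 2 ψ a ∧
      deriv ψ a = -(fderiv ℝ ν (a, ψ a) ((1 : ℝ), (0 : ℝ))) /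
        fderiv ℝ ν (a, ψ a) ((0 : ℝ), (1 : ℝ)) :=
    hev.mono fun a h => hIFT a h.1 h.2
  have hquot := morseC2_tendsto_quotient hν h1 hess (σ := 1) (Or.inl rfl) hψt hslope
  have hlim : Tendsto (deriv ψ) (𝓝[≠] 0) (𝓝 1) :=
    hquot.congr' (hevC.mono fun a h => h.2.symm)
  have hC1 : ContDiffAt ℝ 1 ψ 0 :=
    morseC2_contDiffAt_one_of_punctured hderiv0 (hevC.mono fun a h => h.1.of_le (by norm_num))
      hlim
  -- Step 8: assemble
  have hzero : ∀ᶠ a in 𝓝 (0 : ℝ), ν (a, ψ a) = 0 := by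
    filter_upwards [hδn] with a ha
    by_cases ha0 : a = 0
    · rw [ha0, hψ0]; exact h0
    · exact (hgood a ha0 ha).1
  refine ⟨ψ, hψ0, hderiv0, hC1, hzero, ?_⟩
  filter_upwards [hev, hevC] with a ⟨ha0, ha⟩ ⟨hC2, hd⟩
  obtain ⟨-, hq1, hq2, -, hT⟩ := hgood a ha0 ha
  exact ⟨hq1, hq2, hC2, hT, hd⟩

end PosBranch

section NegBranch

variable {ν : ℝ × ℝ → ℝ}

/-- The reflection `(a, b) ↦ (-a, b)` preserves the hyperbolic normal form: `ν ∘ R` is again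
`C²` with `(ν ∘ R)(0) = 0`, `D(ν ∘ R)(0) = 0`, `D²(ν ∘ R)(0) = diag(-1, 1)`; and
`D(ν ∘ R)(p) w = Dν(R p)(R w)`. [folklore] -/
private theorem morseC2_reflect (hν : ContDiff ℝ 2 ν) (h0 : ν 0 = 0) (h1 : fderiv ℝ ν 0 = 0)
    (h11 : iteratedFDeriv ℝ 2 ν 0 ![((1 : ℝ), (0 : ℝ)), ((1 : ℝ), (0 : ℝ))] = -1)
    (h12 : iteratedFDeriv ℝ 2 ν 0 ![((1 : ℝ), (0 : ℝ)), ((0 : ℝ), (1 : ℝ))] = 0)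
    (h22 : iteratedFDeriv ℝ 2 ν 0 ![((0 : ℝ), (1 : ℝ)), ((0 : ℝ), (1 : ℝ))] = 1) :
    ContDiff ℝ 2 (fun p : ℝ × ℝ => ν (-p.1, p.2)) ∧ (fun p : ℝ × ℝ => ν (-p.1, p.2)) 0 = 0 ∧
      fderiv ℝ (fun p : ℝ × ℝ => ν (-p.1, p.2)) 0 = 0 ∧
      (∀ u w : ℝ × ℝ, fderiv ℝ (fderiv ℝ (fun p : ℝ × ℝ => ν (-p.1, p.2))) 0 u w =
        -(u.1 * w.1) + u.2 * w.2) ∧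
      ∀ p w : ℝ × ℝ, fderiv ℝ (fun p : ℝ × ℝ => ν (-p.1, p.2)) p w =
        fderiv ℝ ν (-p.1, p.2) (-w.1, w.2) := by
  set R : ℝ × ℝ →L[ℝ] ℝ × ℝ :=
    (-ContinuousLinearMap.fst ℝ ℝ ℝ).prod (ContinuousLinearMap.snd ℝ ℝ ℝ) with hRdef
  have hR : ∀ p : ℝ × ℝ, R p = (-p.1, p.2) := fun p => rfl
  have hcomp : (fun p : ℝ × ℝ => ν (-p.1, p.2)) = ν ∘ R := by
    funext p; simp [hR]
  have hcd : ContDiff ℝ 2 (ν ∘ R) := hν.comp R.contDiff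
  have hfd : ∀ p w : ℝ × ℝ, fderiv ℝ (ν ∘ R) p w = fderiv ℝ ν (-p.1, p.2) (-w.1, w.2) := by
    intro p w
    rw [fderiv_comp p ((morseC2_differentiable hν) _) R.differentiableAt, R.fderiv,
      ContinuousLinearMap.comp_apply, hR, hR]
  have hR0 : R 0 = 0 := by simp [hR]
  have h1' : fderiv ℝ (ν ∘ R) 0 = 0 := by
    refine ContinuousLinearMap.ext fun w => ?_
    rw [hfd]
    simp only [Prod.fst_zero, Prod.snd_zero, neg_zero, Prod.mk_zero_zero, h1, zero_apply]
  -- the three Hessian entries of `ν ∘ R`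
  have hI : ∀ u w : ℝ × ℝ, iteratedFDeriv ℝ 2 (ν ∘ R) 0 ![u, w] =
      fderiv ℝ (fderiv ℝ ν) 0 (R u) (R w) := by
    intro u w
    rw [R.iteratedFDeriv_comp_right hν 0 (i := 2) le_rfl,
      ContinuousMultilinearMap.compContinuousLinearMap_apply, hR0, iteratedFDeriv_two_apply]
    simp
  have hess := morseC2_hess_apply hν h11 h12 h22
  have h11' : iteratedFDeriv ℝ 2 (ν ∘ R) 0 ![((1 : ℝ), (0 : ℝ)), ((1 : ℝ), (0 : ℝ))] = -1 := by
    rw [hI, hess]; simp [hR]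
  have h12' : iteratedFDeriv ℝ 2 (ν ∘ R) 0 ![((1 : ℝ), (0 : ℝ)), ((0 : ℝ), (1 : ℝ))] = 0 := by
    rw [hI, hess]; simp [hR]
  have h22' : iteratedFDeriv ℝ 2 (ν ∘ R) 0 ![((0 : ℝ), (1 : ℝ)), ((0 : ℝ), (1 : ℝ))] = 1 := by
    rw [hI, hess]; simp [hR]
  rw [hcomp]
  refine ⟨hcd, by simp [h0], h1', morseC2_hess_apply hcd h11' h12' h22', hfd⟩

/-- `a ↦ -a` maps the punctured neighbourhood of `0` to itself. [folklore] -/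
private theorem morseC2_tendsto_neg_punctured :
    Tendsto (fun a : ℝ => -a) (𝓝[≠] 0) (𝓝[≠] 0) := by
  refine tendsto_nhdsWithin_iff.2 ⟨?_, ?_⟩
  · have : Tendsto (fun a : ℝ => -a) (𝓝 0) (𝓝 0) := by
      simpa using (continuous_neg (G := ℝ)).tendsto 0
    exact this.mono_left nhdsWithin_le_nhds
  · filter_upwards [self_mem_nhdsWithin] with a ha
    simpa using ha

/-- **The negative branch** (`ψ₋` of [II] Lemma A.1), obtained from the positive branch of the
reflected function `ν (-a, b)`: `ψ₋ (a) = ψ̃₊ (-a)`, with `ψ₋ (0) = 0`, `ψ₋' (0) = -1`,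
`ν (a, ψ₋ a) = 0` near `0`, `-2 < ψ₋ a / a < 0` and `ψ₋ ∈ C²` for small `a ≠ 0`.
[cite: FeldmanSalmhoferTrubowitz1998, App. A Lemma A.1 (arXiv p.30 L69–90)] -/
theorem morseC2_exists_negBranch (hν : ContDiff ℝ 2 ν) (h0 : ν 0 = 0) (h1 : fderiv ℝ ν 0 = 0)
    (h11 : iteratedFDeriv ℝ 2 ν 0 ![((1 : ℝ), (0 : ℝ)), ((1 : ℝ), (0 : ℝ))] = -1)
    (h12 : iteratedFDeriv ℝ 2 ν 0 ![((1 : ℝ), (0 : ℝ)), ((0 : ℝ), (1 : ℝ))] = 0)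
    (h22 : iteratedFDeriv ℝ 2 ν 0 ![((0 : ℝ), (1 : ℝ)), ((0 : ℝ), (1 : ℝ))] = 1) :
    ∃ ψ : ℝ → ℝ, ψ 0 = 0 ∧ HasDerivAt ψ (-1) 0 ∧ ContDiffAt ℝ 1 ψ 0 ∧
      (∀ᶠ a in 𝓝 0, ν (a, ψ a) = 0) ∧
      ∀ᶠ a in 𝓝[≠] 0, -2 < ψ a / a ∧ ψ a / a < 0 ∧ ContDiffAt ℝ 2 ψ a := by
  obtain ⟨hcd, h0', h1', hess', hfd⟩ := morseC2_reflect hν h0 h1 h11 h12 h22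
  obtain ⟨φ, hφ0, hφd, hφC, hφz, hφp⟩ := morseC2_exists_posBranch hcd h0' h1' hess'
  refine ⟨fun a => φ (-a), by simpa using hφ0, ?_, ?_, ?_, ?_⟩
  · have h := hφd
    rw [← neg_zero] at h
    have h2 : HasDerivAt (fun a : ℝ => φ (-a)) ((1 : ℝ) * -1) 0 :=
      h.comp (0 : ℝ) (hasDerivAt_neg' (0 : ℝ))
    rw [one_mul] at h2
    exact h2
  · have h := hφC
    rw [← neg_zero] at h
    exact h.comp (0 : ℝ) contDiff_neg.contDiffAt
  · have ht : Tendsto (fun a : ℝ => -a) (𝓝 (0 : ℝ)) (𝓝 0) := by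
      simpa using (continuous_neg (G := ℝ)).tendsto 0
    filter_upwards [ht.eventually hφz] with a ha
    simpa using ha
  · filter_upwards [morseC2_tendsto_neg_punctured.eventually hφp] with a h
    obtain ⟨hq1, hq2, hC, -, -⟩ := h
    have hdiv : φ (-a) / a = -(φ (-a) / -a) := by rw [div_neg, neg_neg]
    refine ⟨by rw [hdiv]; linarith, by rw [hdiv]; linarith, ?_⟩
    have h := hC
    rw [show -a = -a from rfl] at h
    exact h.comp a contDiff_neg.contDiffAt

end NegBranch

section LemmaA1

variable {ν : ℝ × ℝ → ℝ}

/-- `0 < |q| < 2`-type bounds: from `|ψ a / a| < 2` to `|ψ a| < 2 |a|`. [folklore] -/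
private theorem abs_lt_two_mul_abs {x a : ℝ} (ha : a ≠ 0) (h1 : -2 < x / a) (h2 : x / a < 2) :
    |x| < 2 * |a| := by
  have hq : |x / a| < 2 := abs_lt.2 ⟨h1, h2⟩
  rw [abs_div] at hq
  exact (div_lt_iff₀ (abs_pos.2 ha)).1 hq

/-- **[II] Appendix A, Lemma A.1 — the `C²` Morse lemma, hyperbolic case (zero set).**
"Let `ν(φ₁, φ₂)` be a `C²` function in a neighbourhood of `(0,0)` obeying `ν(0,0) = 0`,
`∂₁ν(0,0) = ∂₂ν(0,0) = 0`, `∂₁²ν(0,0) = -1`, `∂₂²ν(0,0) = 1`, `∂₁∂₂ν(0,0) = 0`. There exists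
a neighbourhood `𝒩` of `0` and two `C¹` functions `ψ_±(φ₁)` such that `ν(φ₁, ψ_±(φ₁)) = 0` for
all `φ₁ ∈ 𝒩` and `ψ_±(0) = 0`, `ψ'_±(0) = ±1`" (p.30 L69–90), together with what the proof shows
(p.31 L12–21, "exactly two zeroes"): near `(0,0)` the zero set of `ν` is EXACTLY the union of the
two graphs, the branches are `C²` and distinct off `φ₁ = 0`. Typed for `ν : ℝ × ℝ → ℝ` globally
`C²` (the local statement follows by a smooth cutoff), the Hessian normalisation through
`iteratedFDeriv ℝ 2 ν 0`, "`C¹` in a neighbourhood" as `ContDiffAt ℝ 1 · 0` (equivalent, by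
`ContDiffAt.eventually`). No `C²` Morse lemma exists in Mathlib; [II]: "our functions are only
`C²`, which makes the proof less straightforward … one proof can be found in [MW]; we include
another proof here" (p.30 L63–67). Proof: this file (convexity of the slices, two zeros by the
intermediate value theorem, the implicit function theorem off the critical abscissa, the
`o(1)`-computation of `ψ'_±` at `0`), following [II] p.30 L176–p.31 L71.
[cite: FeldmanSalmhoferTrubowitz1998, App. A Lemma A.1 (arXiv p.30 L69–90; proof p.30 L176–p.31 L71)] -/
theorem morseC2_hyperbolic_zero_branches (hν : ContDiff ℝ 2 ν) (h0 : ν 0 = 0)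
    (h1 : fderiv ℝ ν 0 = 0)
    (h11 : iteratedFDeriv ℝ 2 ν 0 ![((1 : ℝ), (0 : ℝ)), ((1 : ℝ), (0 : ℝ))] = -1)
    (h12 : iteratedFDeriv ℝ 2 ν 0 ![((1 : ℝ), (0 : ℝ)), ((0 : ℝ), (1 : ℝ))] = 0)
    (h22 : iteratedFDeriv ℝ 2 ν 0 ![((0 : ℝ), (1 : ℝ)), ((0 : ℝ), (1 : ℝ))] = 1) :
    ∃ ψp ψm : ℝ → ℝ,
      (ContDiffAt ℝ 1 ψp 0 ∧ ψp 0 = 0 ∧ HasDerivAt ψp 1 0 ∧ ∀ᶠ a in 𝓝 0, ν (a, ψp a) = 0) ∧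
      (ContDiffAt ℝ 1 ψm 0 ∧ ψm 0 = 0 ∧ HasDerivAt ψm (-1) 0 ∧
        ∀ᶠ a in 𝓝 0, ν (a, ψm a) = 0) ∧
      (∀ᶠ a in 𝓝[≠] 0, ContDiffAt ℝ 2 ψp a ∧ ContDiffAt ℝ 2 ψm a ∧ ψm a ≠ ψp a) ∧
      ∀ᶠ p in 𝓝 (0 : ℝ × ℝ), ν p = 0 ↔ p.2 = ψp p.1 ∨ p.2 = ψm p.1 := by
  have hess := morseC2_hess_apply hν h11 h12 h22
  obtain ⟨ψp, hp0, hpd, hpC, hpz, hpev⟩ := morseC2_exists_posBranch hν h0 h1 hess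
  obtain ⟨ψm, hm0, hmd, hmC, hmz, hmev⟩ := morseC2_exists_negBranch hν h0 h1 h11 h12 h22
  refine ⟨ψp, ψm, ⟨hpC, hp0, hpd, hpz⟩, ⟨hmC, hm0, hmd, hmz⟩, ?_, ?_⟩
  · filter_upwards [hpev, hmev] with a h h'
    obtain ⟨hq1, -, hC, -, -⟩ := h
    obtain ⟨-, hq2, hC'⟩ := h'
    refine ⟨hC, hC', fun heq => ?_⟩
    rw [heq] at hq2
    linarith
  · have h22' : fderiv ℝ (fderiv ℝ ν) 0 ((0 : ℝ), (1 : ℝ)) ((0 : ℝ), (1 : ℝ)) = 1 := by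
      rw [hess]; norm_num
    obtain ⟨ρ, hρ, hbox⟩ := morseC2_exists_box hν h22'
    obtain ⟨δ, hδ, hδρ, hzeros⟩ := morseC2_exists_zeros hν h0 h1 hess hρ
    have hP := hpev.and hmev
    rw [eventually_nhdsWithin_iff, Metric.eventually_nhds_iff] at hP
    obtain ⟨ε, hε, hP⟩ := hP
    have hZ := hpz.and hmz
    rw [Metric.eventually_nhds_iff] at hZ
    obtain ⟨ε₂, hε₂, hZ⟩ := hZ
    refine Metric.eventually_nhds_iff.2
      ⟨min (min ε ε₂) (min δ ρ), lt_min (lt_min hε hε₂) (lt_min hδ hρ), fun p hp => ?_⟩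
    rw [dist_zero_right] at hp
    have hp1 : |p.1| < min (min ε ε₂) (min δ ρ) :=
      lt_of_le_of_lt (by simpa [Real.norm_eq_abs] using norm_fst_le p) hp
    have hp2 : |p.2| < min (min ε ε₂) (min δ ρ) :=
      lt_of_le_of_lt (by simpa [Real.norm_eq_abs] using norm_snd_le p) hp
    have hp2ρ : p.2 ∈ Ioo (-ρ) ρ :=
      abs_lt.1 (hp2.trans_le ((min_le_right _ _).trans (min_le_right _ _)))
    have hpeq : p = (p.1, p.2) := rfl
    by_cases ha0 : p.1 = 0
    · -- the slice `a = 0`: a double zero at `b = 0`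
      have hd : ∀ b ∈ Ioo (-ρ) ρ, HasDerivAt (fun b : ℝ => ν (0, b))
          (fderiv ℝ ν (0, b) ((0 : ℝ), (1 : ℝ))) b := fun b _ => morseC2_hasDerivAt_slice hν 0 b
      have hmono := morseC2_strictMonoOn_slice hν hbox (a := 0) (by simpa using hρ)
      have hφ0 : (fun b : ℝ => ν (0, b)) 0 = 0 := by
        simp only [Prod.mk_zero_zero]; exact h0
      have hφ0' : fderiv ℝ ν ((0 : ℝ), (0 : ℝ)) ((0 : ℝ), (1 : ℝ)) = 0 := by
        rw [Prod.mk_zero_zero, h1]; rfl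
      have huniq := morseC2_zero_unique_of_double hd hmono hρ hφ0 hφ0'
      constructor
      · intro hν0
        rw [hpeq, ha0] at hν0
        have hb : p.2 = 0 := huniq p.2 hp2ρ hν0
        left
        rw [hb, ha0, hp0]
      · intro h
        have hb : p.2 = 0 := by
          rcases h with h | h
          · rw [h, ha0, hp0]
          · rw [h, ha0, hm0]
        have : p = 0 := Prod.ext ha0 hb
        rw [this]; exact h0
    · -- `a ≠ 0`: the two zeros of the slice are `ψp a` and `ψm a`
      have hpε : dist p.1 0 < ε := by
        rw [dist_zero_right, Real.norm_eq_abs]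
        exact hp1.trans_le ((min_le_left _ _).trans (min_le_left _ _))
      have hpε₂ : dist p.1 0 < ε₂ := by
        rw [dist_zero_right, Real.norm_eq_abs]
        exact hp1.trans_le ((min_le_left _ _).trans (min_le_right _ _))
      have hpδ : |p.1| < δ := hp1.trans_le ((min_le_right _ _).trans (min_le_left _ _))
      obtain ⟨⟨hq1, hq1', -, -, -⟩, ⟨hq2, hq2', -⟩⟩ := hP hpε ha0
      obtain ⟨hzp, hzm⟩ := hZ hpε₂
      obtain ⟨-, ⟨bp, hbpI, hbp0⟩, ⟨bn, hbnI, hbn0⟩⟩ := hzeros p.1 ha0 hpδ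
      have h2a : 2 * |p.1| < ρ := by linarith
      obtain ⟨-, huniq⟩ := morseC2_zeros_of_strictMonoOn_deriv (φ := fun b => ν (p.1, b))
        (φ' := fun b => fderiv ℝ ν (p.1, b) ((0 : ℝ), (1 : ℝ)))
        (fun b _ => morseC2_hasDerivAt_slice hν p.1 b)
        (morseC2_strictMonoOn_slice hν hbox (by linarith [abs_nonneg p.1]))
        ⟨by linarith [hbnI.1], by linarith [hbnI.2]⟩ ⟨by linarith [hbpI.1], by linarith [hbpI.2]⟩
        (hbnI.2.trans hbpI.1) hbn0 hbp0
      have hψpI : ψp p.1 ∈ Ioo (-ρ) ρ := by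
        have := abs_lt_two_mul_abs ha0 (by linarith) hq1'
        exact ⟨by linarith [(abs_lt.1 this).1, neg_abs_le (ψp p.1), abs_nonneg (ψp p.1),
          (abs_lt.1 this).2], by linarith [le_abs_self (ψp p.1), (abs_lt.1 this).2]⟩
      have hψmI : ψm p.1 ∈ Ioo (-ρ) ρ := by
        have := abs_lt_two_mul_abs ha0 hq2 (by linarith)
        exact ⟨by linarith [neg_abs_le (ψm p.1), (abs_lt.1 this).2],
          by linarith [le_abs_self (ψm p.1), (abs_lt.1 this).2]⟩
      have hne : ψm p.1 ≠ ψp p.1 := by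
        intro heq; rw [heq] at hq2'; linarith
      have hp' := huniq (ψp p.1) hψpI hzp
      have hm' := huniq (ψm p.1) hψmI hzm
      constructor
      · intro hν0
        rw [hpeq] at hν0
        rcases huniq p.2 hp2ρ hν0 with hb | hb
        · -- p.2 = bn
          rcases hm' with hm' | hm'
          · right; rw [hb, hm']
          · rcases hp' with hp' | hp'
            · left; rw [hb, hp']
            · exact absurd (hm'.trans hp'.symm) hne
        · rcases hp' with hp' | hp'
          · rcases hm' with hm' | hm'
            · exact absurd (hm'.trans hp'.symm) hne
            · right; rw [hb, hm']
          · left; rw [hb, hp']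
      · intro h
        rcases h with h | h
        · rw [hpeq, h]; exact hzp
        · rw [hpeq, h]; exact hzm

end LemmaA1

section TheoremA2

open Literature.Analysis.Calculus (partialFDerivFst hasFDerivAt_partialFDerivFst
  hasFDerivAt_intervalIntegral_partialFDerivFst contDiff_intervalIntegral)
open MeasureTheory intervalIntegral

variable {ν : ℝ × ℝ → ℝ}

/-- Globalisation by a smooth cutoff: a function `C¹` at `0` agrees near `0` with a globally
`C¹` function (bump `≡ 1` on a small ball, supported where the function is `C¹`). [folklore] -/
private theorem morseC2_exists_global_contDiff {ψ : ℝ → ℝ} (hψ : ContDiffAt ℝ 1 ψ 0) :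
    ∃ χ : ℝ → ℝ, ContDiff ℝ 1 χ ∧ ∀ᶠ a in 𝓝 0, χ a = ψ a := by
  obtain ⟨ε, hε, hball⟩ := Metric.eventually_nhds_iff.1 (hψ.eventually (by simp))
  let φ : ContDiffBump (0 : ℝ) := ⟨ε / 4, ε / 2, by positivity, by linarith⟩
  refine ⟨fun a => φ a * ψ a, ?_, ?_⟩
  · rw [contDiff_iff_contDiffAt]
    intro a
    by_cases ha : dist a 0 < ε
    · exact φ.contDiff.contDiffAt.mul (hball ha)
    · have hnot : a ∉ tsupport (φ : ℝ → ℝ) := by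
        rw [φ.tsupport_eq]
        intro h
        have : dist a 0 ≤ ε / 2 := Metric.mem_closedBall.1 h
        linarith
      have hev : (fun a => φ a * ψ a) =ᶠ[𝓝 a] fun _ => 0 := by
        filter_upwards [notMem_tsupport_iff_eventuallyEq.1 hnot] with b hb
        simp [hb]
      exact contDiffAt_const.congr_of_eventuallyEq hev
  · filter_upwards [Metric.closedBall_mem_nhds (0 : ℝ) (by positivity : (0 : ℝ) < ε / 4)]
      with a ha
    rw [φ.one_of_mem_closedBall ha, one_mul]

/-- **[II] Appendix A, Theorem A.2 — the `C²` Morse lemma, hyperbolic case (factorisation).**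
"There exist `C¹` functions `x(φ₁,φ₂)` and `y(φ₁,φ₂)` in a neighbourhood of `(0,0)` such that
`ν(φ₁,φ₂) = x(φ₁,φ₂) y(φ₁,φ₂)` and `x(0,0) = y(0,0) = 0`" with the table of first derivatives
(p.30 L94–107); proof p.31 L72–89: "`x = φ₂ - ψ₊(φ₁)`,
`y = ∫₀¹ dα ∂₂ν(φ₁, (1-α)ψ₊(φ₁) + αφ₂)`; then `ν = xy` holds by Taylor expansion". DERIVATIVE
TABLE: the print lists `∂₁x(0,0) = 1`, `∂₂x(0,0) = -1`, `∂₁y(0,0) = -1/2`, `∂₂y(0,0) = 1/2`,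
which is inconsistent with `ν = xy` (it would give `xy = -(φ₁-φ₂)²/2 ≠ (φ₂²-φ₁²)/2 ≈ ν`) and
with the proof's own `x = φ₂ - ψ₊(φ₁)` (p.31 L86–88: "`∂₁x(0,0) = -1`, `∂₂x(0,0) = 1` … obvious") —
a sign slip in print. Typed in the form the proof establishes and the kernel certifies:
`Dx(0) = (h,k) ↦ k - h`, `Dy(0) = (h,k) ↦ (h + k)/2` (so `xy = (k-h)(k+h)/2 = ν` to second
order, and `D(x,y)(0)` has determinant `-1`: `(x,y)` is a local `C¹` change of variables, which
is how App. B uses it, p.35 L99–106). Typed with `ν` globally `C²`, "`C¹` in a neighbourhood"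
as `ContDiffAt ℝ 1 · 0`, the identity on a neighbourhood of `0`; `y` is `C¹` by differentiation
under the integral (`Literature.Analysis.Calculus.contDiff_intervalIntegral`).
[cite: FeldmanSalmhoferTrubowitz1998, App. A Theorem A.2 (arXiv p.30 L94–107; proof p.31 L72–89)] -/
theorem morseC2_hyperbolic_factorisation (hν : ContDiff ℝ 2 ν) (h0 : ν 0 = 0)
    (h1 : fderiv ℝ ν 0 = 0)
    (h11 : iteratedFDeriv ℝ 2 ν 0 ![((1 : ℝ), (0 : ℝ)), ((1 : ℝ), (0 : ℝ))] = -1)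
    (h12 : iteratedFDeriv ℝ 2 ν 0 ![((1 : ℝ), (0 : ℝ)), ((0 : ℝ), (1 : ℝ))] = 0)
    (h22 : iteratedFDeriv ℝ 2 ν 0 ![((0 : ℝ), (1 : ℝ)), ((0 : ℝ), (1 : ℝ))] = 1) :
    ∃ x y : ℝ × ℝ → ℝ, ContDiffAt ℝ 1 x 0 ∧ ContDiffAt ℝ 1 y 0 ∧
      (∀ᶠ p in 𝓝 (0 : ℝ × ℝ), ν p = x p * y p) ∧ x 0 = 0 ∧ y 0 = 0 ∧
      HasFDerivAt x (ContinuousLinearMap.snd ℝ ℝ ℝ - ContinuousLinearMap.fst ℝ ℝ ℝ) 0 ∧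
      HasFDerivAt y
        ((1 / 2 : ℝ) • (ContinuousLinearMap.fst ℝ ℝ ℝ + ContinuousLinearMap.snd ℝ ℝ ℝ)) 0 := by
  have hess := morseC2_hess_apply hν h11 h12 h22
  obtain ⟨ψ, hψ0, hψd, hψC, hψz, -⟩ := morseC2_exists_posBranch hν h0 h1 hess
  obtain ⟨χ, hχC, hχeq⟩ := morseC2_exists_global_contDiff hψC
  have hχ0 : χ 0 = 0 := by rw [hχeq.self_of_nhds, hψ0]
  have hχd : HasDerivAt χ 1 0 := hψd.congr_of_eventuallyEq hχeq
  -- `∂₂ν` as a global `C¹` function, and the integrand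
  set g : ℝ × ℝ → ℝ := fun q => fderiv ℝ ν q ((0 : ℝ), (1 : ℝ)) with hg
  have hgC : ContDiff ℝ 1 g := morseC2_contDiff_partial hν _
  set F : ℝ × ℝ → ℝ → ℝ := fun p t => g (p.1, (1 - t) * χ p.1 + t * p.2) with hF
  have hFC : ContDiff ℝ 1 (Function.uncurry F) := by
    have : Function.uncurry F =
        g ∘ fun z : (ℝ × ℝ) × ℝ => (z.1.1, (1 - z.2) * χ z.1.1 + z.2 * z.1.2) := by
      funext z; rfl
    rw [this]
    refine hgC.comp ?_
    refine (contDiff_fst.comp contDiff_fst).prodMk ?_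
    exact ((contDiff_const.sub contDiff_snd).mul (hχC.comp (contDiff_fst.comp contDiff_fst))).add
      (contDiff_snd.mul (contDiff_snd.comp contDiff_fst))
  refine ⟨fun p => p.2 - ψ p.1, fun p => ∫ t in (0 : ℝ)..1, F p t, ?_, ?_, ?_, by simp [hψ0],
    ?_, ?_, ?_⟩
  · -- `x` is `C¹` at `0`
    exact contDiffAt_snd.sub (hψC.comp (0 : ℝ × ℝ) contDiffAt_fst)
  · -- `y` is `C¹` (everywhere)
    exact (contDiff_intervalIntegral (n := 1) (by exact_mod_cast hFC) 0 1).contDiffAt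
  · -- `ν = x y` near `0`: the fundamental theorem of calculus on the vertical segment
    have hfst : Tendsto (fun p : ℝ × ℝ => p.1) (𝓝 (0 : ℝ × ℝ)) (𝓝 0) :=
      continuous_fst.tendsto' (0 : ℝ × ℝ) 0 rfl
    filter_upwards [hfst.eventually hχeq, hfst.eventually hψz] with p hpχ hpz
    have hG : ∀ t : ℝ, HasDerivAt (fun t : ℝ => ν (p.1, ψ p.1 + t * (p.2 - ψ p.1)))
        ((p.2 - ψ p.1) * g (p.1, ψ p.1 + t * (p.2 - ψ p.1))) t := by
      intro t
      have hpath : HasDerivAt (fun t : ℝ => (p.1, ψ p.1 + t * (p.2 - ψ p.1)))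
          ((0 : ℝ), 1 * (p.2 - ψ p.1)) t :=
        (hasDerivAt_const t p.1).prodMk (((hasDerivAt_id t).mul_const (p.2 - ψ p.1)).const_add
          (ψ p.1))
      have h := ((morseC2_differentiable hν) (p.1, ψ p.1 + t * (p.2 - ψ p.1))).hasFDerivAt
        |>.comp_hasDerivAt t hpath
      have heq : fderiv ℝ ν (p.1, ψ p.1 + t * (p.2 - ψ p.1)) ((0 : ℝ), 1 * (p.2 - ψ p.1)) =
          (p.2 - ψ p.1) * g (p.1, ψ p.1 + t * (p.2 - ψ p.1)) := by
        rw [lin_prod_apply]; simp [hg]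
      rw [heq] at h
      exact h
    have hint : IntervalIntegrable (fun t : ℝ => (p.2 - ψ p.1) * g (p.1, ψ p.1 + t * (p.2 - ψ p.1)))
        volume 0 1 := by
      refine (continuous_const.mul (hgC.continuous.comp ?_)).intervalIntegrable 0 1
      exact continuous_const.prodMk (continuous_const.add (continuous_id.mul continuous_const))
    have hFTC := integral_eq_sub_of_hasDerivAt (fun t _ => hG t) hint
    simp only [zero_mul, add_zero, one_mul] at hFTC
    have hcb : ψ p.1 + (p.2 - ψ p.1) = p.2 := by ring
    rw [hcb, hpz, sub_zero] at hFTC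
    have hF' : (fun t : ℝ => F p t) = fun t => g (p.1, ψ p.1 + t * (p.2 - ψ p.1)) := by
      funext t
      simp only [hF, hpχ]
      congr 1
      ext
      · simp
      · simp; ring
    calc ν p = ν (p.1, p.2) := rfl
      _ = ∫ t in (0 : ℝ)..1, (p.2 - ψ p.1) * g (p.1, ψ p.1 + t * (p.2 - ψ p.1)) := hFTC.symm
      _ = (p.2 - ψ p.1) * ∫ t in (0 : ℝ)..1, g (p.1, ψ p.1 + t * (p.2 - ψ p.1)) :=
          intervalIntegral.integral_const_mul _ _
      _ = (p.2 - ψ p.1) * ∫ t in (0 : ℝ)..1, F p t := by rw [hF']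
  · -- `y (0) = 0`
    have : (fun t : ℝ => F 0 t) = fun _ => 0 := by
      funext t
      simp only [hF, hg, Prod.fst_zero, Prod.snd_zero, hχ0, mul_zero, add_zero,
        Prod.mk_zero_zero, h1, zero_apply]
    simp [this]
  · -- `Dx (0) = (h, k) ↦ k - h`
    have h1' : HasFDerivAt (fun p : ℝ × ℝ => ψ p.1)
        ((ContinuousLinearMap.smulRight (1 : ℝ →L[ℝ] ℝ) (1 : ℝ)).comp
          (ContinuousLinearMap.fst ℝ ℝ ℝ)) 0 :=
      hψd.hasFDerivAt.comp (0 : ℝ × ℝ) hasFDerivAt_fst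
    refine (hasFDerivAt_snd.sub h1').congr_fderiv ?_
    refine ContinuousLinearMap.ext fun v => ?_
    simp
  · -- `Dy (0) = (h, k) ↦ (h + k)/2`: differentiation under the integral sign
    have hdiffF : ∀ t : ℝ, DifferentiableAt ℝ (Function.uncurry F) ((0 : ℝ × ℝ), t) := fun t =>
      (hFC.differentiable one_ne_zero).differentiableAt
    have hmine : ∀ t : ℝ, HasFDerivAt (fun p : ℝ × ℝ => F p t)
        ((1 - t) • ContinuousLinearMap.fst ℝ ℝ ℝ + t • ContinuousLinearMap.snd ℝ ℝ ℝ) 0 := by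
      intro t
      have hχ' : HasFDerivAt (fun p : ℝ × ℝ => χ p.1)
          ((ContinuousLinearMap.smulRight (1 : ℝ →L[ℝ] ℝ) (1 : ℝ)).comp
            (ContinuousLinearMap.fst ℝ ℝ ℝ)) 0 :=
        hχd.hasFDerivAt.comp (0 : ℝ × ℝ) hasFDerivAt_fst
      have hin : HasFDerivAt (fun p : ℝ × ℝ => (p.1, (1 - t) * χ p.1 + t * p.2))
          ((ContinuousLinearMap.fst ℝ ℝ ℝ).prod
            ((1 - t) • ((ContinuousLinearMap.smulRight (1 : ℝ →L[ℝ] ℝ) (1 : ℝ)).comp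
              (ContinuousLinearMap.fst ℝ ℝ ℝ)) + t • ContinuousLinearMap.snd ℝ ℝ ℝ)) 0 :=
        hasFDerivAt_fst.prodMk ((hχ'.const_mul (1 - t)).add (hasFDerivAt_snd.const_mul t))
      have hin0 : (fun p : ℝ × ℝ => (p.1, (1 - t) * χ p.1 + t * p.2)) 0 = 0 := by
        simp [hχ0]
      have hgd : HasFDerivAt g ((fderiv ℝ (fderiv ℝ ν) 0).flip ((0 : ℝ), (1 : ℝ)))
          ((fun p : ℝ × ℝ => (p.1, (1 - t) * χ p.1 + t * p.2)) 0) := by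
        rw [hin0]; exact morseC2_hasFDerivAt_partial hν _ 0
      refine (hgd.comp (0 : ℝ × ℝ) hin).congr_fderiv ?_
      refine ContinuousLinearMap.ext fun v => ?_
      simp [ContinuousLinearMap.flip_apply, hess]
    have hpF : ∀ t : ℝ, partialFDerivFst F 0 t =
        (1 - t) • ContinuousLinearMap.fst ℝ ℝ ℝ + t • ContinuousLinearMap.snd ℝ ℝ ℝ := fun t =>
      (hasFDerivAt_partialFDerivFst (hdiffF t)).unique (hmine t)
    have i0 : IntervalIntegrable (fun _ : ℝ => (1 : ℝ)) volume 0 1 :=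
      continuous_const.intervalIntegrable 0 1
    have i0' : IntervalIntegrable (fun t : ℝ => t) volume 0 1 := continuous_id.intervalIntegrable 0 1
    have e1 : ∫ t in (0 : ℝ)..1, (1 - t) = 1 / 2 := by
      rw [intervalIntegral.integral_sub i0 i0', intervalIntegral.integral_const, integral_id]
      norm_num
    have e2 : ∫ t in (0 : ℝ)..1, t = 1 / 2 := by rw [integral_id]; norm_num
    have hI : ∫ t in (0 : ℝ)..1, partialFDerivFst F 0 t =
        (1 / 2 : ℝ) • (ContinuousLinearMap.fst ℝ ℝ ℝ + ContinuousLinearMap.snd ℝ ℝ ℝ) := by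
      have i1 : IntervalIntegrable (fun t : ℝ => (1 - t) • ContinuousLinearMap.fst ℝ ℝ ℝ)
          volume 0 1 :=
        ((continuous_const.sub continuous_id).smul continuous_const).intervalIntegrable 0 1
      have i2 : IntervalIntegrable (fun t : ℝ => t • ContinuousLinearMap.snd ℝ ℝ ℝ) volume 0 1 :=
        (continuous_id.smul continuous_const).intervalIntegrable 0 1
      rw [intervalIntegral.integral_congr (fun t _ => hpF t), intervalIntegral.integral_add i1 i2,
        intervalIntegral.integral_smul_const, intervalIntegral.integral_smul_const, e1, e2,
        smul_add]
    exact (hasFDerivAt_intervalIntegral_partialFDerivFst hFC one_ne_zero 0 1 0).congr_fderiv hI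

end TheoremA2

section Germ

variable {ν : ℝ × ℝ → ℝ}

/-- Smooth cutoff in the plane: a function `C²` near `0` agrees near `0` with a globally `C²`
function. [folklore] -/
private theorem morseC2_exists_global_C2 (hν : ∀ᶠ p in 𝓝 (0 : ℝ × ℝ), ContDiffAt ℝ 2 ν p) :
    ∃ μ : ℝ × ℝ → ℝ, ContDiff ℝ 2 μ ∧ ∀ᶠ p in 𝓝 (0 : ℝ × ℝ), μ p = ν p := by
  obtain ⟨ε, hε, hball⟩ := Metric.eventually_nhds_iff.1 hν
  let φ : ContDiffBump (0 : ℝ × ℝ) := ⟨ε / 4, ε / 2, by positivity, by linarith⟩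
  refine ⟨fun p => φ p * ν p, ?_, ?_⟩
  · rw [contDiff_iff_contDiffAt]
    intro p
    by_cases hp : dist p 0 < ε
    · exact φ.contDiff.contDiffAt.mul (hball hp)
    · have hnot : p ∉ tsupport (φ : ℝ × ℝ → ℝ) := by
        rw [φ.tsupport_eq]
        intro h
        have : dist p 0 ≤ ε / 2 := Metric.mem_closedBall.1 h
        linarith
      have hev : (fun p => φ p * ν p) =ᶠ[𝓝 p] fun _ => 0 := by
        filter_upwards [notMem_tsupport_iff_eventuallyEq.1 hnot] with q hq
        simp [hq]
      exact contDiffAt_const.congr_of_eventuallyEq hev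
  · filter_upwards [Metric.closedBall_mem_nhds (0 : ℝ × ℝ) (by positivity : (0 : ℝ) < ε / 4)]
      with p hp
    rw [φ.one_of_mem_closedBall hp, one_mul]

/-- **Lemma A.1 with the printed (local) hypothesis** "`ν` a `C²` function in a neighbourhood of
`(0,0)`" (p.30 L70): the conclusions of `morseC2_hyperbolic_zero_branches` hold for `ν` that is
`C²` at every point of a neighbourhood of `0` (reduction to the global case by a smooth cutoff,
which does not change `ν` near `0`, hence neither its derivatives at `0` nor its zero set there).
[cite: FeldmanSalmhoferTrubowitz1998, App. A Lemma A.1 (arXiv p.30 L69–90)] -/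
theorem morseC2_hyperbolic_zero_branches_local (hν : ∀ᶠ p in 𝓝 (0 : ℝ × ℝ), ContDiffAt ℝ 2 ν p)
    (h0 : ν 0 = 0) (h1 : fderiv ℝ ν 0 = 0)
    (h11 : iteratedFDeriv ℝ 2 ν 0 ![((1 : ℝ), (0 : ℝ)), ((1 : ℝ), (0 : ℝ))] = -1)
    (h12 : iteratedFDeriv ℝ 2 ν 0 ![((1 : ℝ), (0 : ℝ)), ((0 : ℝ), (1 : ℝ))] = 0)
    (h22 : iteratedFDeriv ℝ 2 ν 0 ![((0 : ℝ), (1 : ℝ)), ((0 : ℝ), (1 : ℝ))] = 1) :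
    ∃ ψp ψm : ℝ → ℝ,
      (ContDiffAt ℝ 1 ψp 0 ∧ ψp 0 = 0 ∧ HasDerivAt ψp 1 0 ∧ ∀ᶠ a in 𝓝 0, ν (a, ψp a) = 0) ∧
      (ContDiffAt ℝ 1 ψm 0 ∧ ψm 0 = 0 ∧ HasDerivAt ψm (-1) 0 ∧
        ∀ᶠ a in 𝓝 0, ν (a, ψm a) = 0) ∧
      (∀ᶠ a in 𝓝[≠] 0, ContDiffAt ℝ 2 ψp a ∧ ContDiffAt ℝ 2 ψm a ∧ ψm a ≠ ψp a) ∧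
      ∀ᶠ p in 𝓝 (0 : ℝ × ℝ), ν p = 0 ↔ p.2 = ψp p.1 ∨ p.2 = ψm p.1 := by
  obtain ⟨μ, hμ, hμν⟩ := morseC2_exists_global_C2 hν
  have hμ0 : μ 0 = 0 := by rw [hμν.self_of_nhds, h0]
  have hμν' : μ =ᶠ[𝓝 0] ν := hμν
  have hμ1 : fderiv ℝ μ 0 = 0 := by rw [hμν'.fderiv_eq, h1]
  have hμ2 : iteratedFDeriv ℝ 2 μ 0 = iteratedFDeriv ℝ 2 ν 0 := (hμν'.iteratedFDeriv ℝ 2).eq_of_nhds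
  obtain ⟨ψp, ψm, hp, hm, hpunct, hzero⟩ := morseC2_hyperbolic_zero_branches hμ hμ0 hμ1
    (by rw [hμ2]; exact h11) (by rw [hμ2]; exact h12) (by rw [hμ2]; exact h22)
  have pull : ∀ {ψ : ℝ → ℝ}, ContDiffAt ℝ 1 ψ 0 → ψ 0 = 0 → (∀ᶠ a in 𝓝 0, μ (a, ψ a) = 0) →
      ∀ᶠ a in 𝓝 0, ν (a, ψ a) = 0 := by
    intro ψ hC hz0 hz
    have ht : Tendsto (fun a : ℝ => (a, ψ a)) (𝓝 0) (𝓝 0) := by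
      have := (continuous_id.tendsto (0 : ℝ)).prodMk_nhds hC.continuousAt.tendsto
      rwa [hz0, id, Prod.mk_zero_zero] at this
    filter_upwards [hz, ht.eventually hμν] with a ha hb
    rw [← hb]; exact ha
  refine ⟨ψp, ψm, ⟨hp.1, hp.2.1, hp.2.2.1, pull hp.1 hp.2.1 hp.2.2.2⟩,
    ⟨hm.1, hm.2.1, hm.2.2.1, pull hm.1 hm.2.1 hm.2.2.2⟩, hpunct, ?_⟩
  filter_upwards [hzero, hμν] with p h1 h2
  rw [← h2]; exact h1

/-- **Theorem A.2 with the printed (local) hypothesis** (p.30 L70, L94: "`C²` in a neighbourhood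
of `(0,0)`"): the conclusions of `morseC2_hyperbolic_factorisation` for `ν` that is `C²` at every
point of a neighbourhood of `0`.
[cite: FeldmanSalmhoferTrubowitz1998, App. A Theorem A.2 (arXiv p.30 L94–107)] -/
theorem morseC2_hyperbolic_factorisation_local (hν : ∀ᶠ p in 𝓝 (0 : ℝ × ℝ), ContDiffAt ℝ 2 ν p)
    (h0 : ν 0 = 0) (h1 : fderiv ℝ ν 0 = 0)
    (h11 : iteratedFDeriv ℝ 2 ν 0 ![((1 : ℝ), (0 : ℝ)), ((1 : ℝ), (0 : ℝ))] = -1)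
    (h12 : iteratedFDeriv ℝ 2 ν 0 ![((1 : ℝ), (0 : ℝ)), ((0 : ℝ), (1 : ℝ))] = 0)
    (h22 : iteratedFDeriv ℝ 2 ν 0 ![((0 : ℝ), (1 : ℝ)), ((0 : ℝ), (1 : ℝ))] = 1) :
    ∃ x y : ℝ × ℝ → ℝ, ContDiffAt ℝ 1 x 0 ∧ ContDiffAt ℝ 1 y 0 ∧
      (∀ᶠ p in 𝓝 (0 : ℝ × ℝ), ν p = x p * y p) ∧ x 0 = 0 ∧ y 0 = 0 ∧
      HasFDerivAt x (ContinuousLinearMap.snd ℝ ℝ ℝ - ContinuousLinearMap.fst ℝ ℝ ℝ) 0 ∧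
      HasFDerivAt y
        ((1 / 2 : ℝ) • (ContinuousLinearMap.fst ℝ ℝ ℝ + ContinuousLinearMap.snd ℝ ℝ ℝ)) 0 := by
  obtain ⟨μ, hμ, hμν⟩ := morseC2_exists_global_C2 hν
  have hμ0 : μ 0 = 0 := by rw [hμν.self_of_nhds, h0]
  have hμν' : μ =ᶠ[𝓝 0] ν := hμν
  have hμ1 : fderiv ℝ μ 0 = 0 := by rw [hμν'.fderiv_eq, h1]
  have hμ2 : iteratedFDeriv ℝ 2 μ 0 = iteratedFDeriv ℝ 2 ν 0 := (hμν'.iteratedFDeriv ℝ 2).eq_of_nhds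
  obtain ⟨x, y, hx, hy, hxy, hx0, hy0, hdx, hdy⟩ := morseC2_hyperbolic_factorisation hμ hμ0 hμ1
    (by rw [hμ2]; exact h11) (by rw [hμ2]; exact h12) (by rw [hμ2]; exact h22)
  refine ⟨x, y, hx, hy, ?_, hx0, hy0, hdx, hdy⟩
  filter_upwards [hxy, hμν] with p h1 h2
  rw [← h2]; exact h1

end Germ

section Elliptic

variable {ν : ℝ × ℝ → ℝ}

/-- The Hessian of `ν` at `0` in coordinates, elliptic normalisation `D²ν(0) = 1`. [folklore] -/
private theorem morseC2_hess_apply_elliptic (hν : ContDiff ℝ 2 ν)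
    (h11 : iteratedFDeriv ℝ 2 ν 0 ![((1 : ℝ), (0 : ℝ)), ((1 : ℝ), (0 : ℝ))] = 1)
    (h12 : iteratedFDeriv ℝ 2 ν 0 ![((1 : ℝ), (0 : ℝ)), ((0 : ℝ), (1 : ℝ))] = 0)
    (h22 : iteratedFDeriv ℝ 2 ν 0 ![((0 : ℝ), (1 : ℝ)), ((0 : ℝ), (1 : ℝ))] = 1) (u w : ℝ × ℝ) :
    fderiv ℝ (fderiv ℝ ν) 0 u w = u.1 * w.1 + u.2 * w.2 := by
  have hsymm : IsSymmSndFDerivAt ℝ ν 0 := hν.contDiffAt.isSymmSndFDerivAt (by simp)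
  rw [iteratedFDeriv_two_apply] at h11 h12 h22
  simp only [Matrix.cons_val_zero, Matrix.cons_val_one] at h11 h12 h22
  have h21 : fderiv ℝ (fderiv ℝ ν) 0 ((0 : ℝ), (1 : ℝ)) ((1 : ℝ), (0 : ℝ)) = 0 := by
    rw [hsymm]; exact h12
  rw [bilin_prod_apply, h11, h12, h21, h22]; ring

/-- `‖p‖² ≤ p₁² + p₂²` for the sup norm of `ℝ × ℝ`. [folklore] -/
private theorem norm_sq_le_sum_sq (p : ℝ × ℝ) : ‖p‖ * ‖p‖ ≤ p.1 ^ 2 + p.2 ^ 2 := by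
  rw [Prod.norm_def, Real.norm_eq_abs, Real.norm_eq_abs]
  rcases le_total |p.1| |p.2| with h | h
  · rw [max_eq_right h]
    nlinarith [sq_abs p.2, sq_nonneg p.1, abs_nonneg p.2]
  · rw [max_eq_left h]
    nlinarith [sq_abs p.1, sq_nonneg p.2, abs_nonneg p.1]

/-- **[II] Appendix A, elliptic case — the Jacobian `∂(R,θ)/∂(φ₁,φ₂) = 1 + o(1)`** (p.31
L90–110 with L139–161). For `ν ∈ C²` with `ν(0) = 0`, `Dν(0) = 0`, `D²ν(0) = 1` and the
polar-type coordinates `R = ν(φ₁,φ₂)`, `θ =` the polar angle, the Jacobian determinant is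
`∂(R,θ)/∂(φ₁,φ₂) = (α̂φ₁² + 2β̂φ₁φ₂ + γ̂φ₂²)/(φ₁²+φ₂²) = 1 + o(1)` (p.31 L150–161), i.e.
`(φ₁∂₁ν + φ₂∂₂ν)/(φ₁² + φ₂²) → 1` as `(φ₁,φ₂) → 0`. Typed as that limit along `𝓝[≠] 0`
(global `C²` hypothesis as in the hyperbolic case); proved from `∂ᵢν(p) = pᵢ + o(|p|)`.
[cite: FeldmanSalmhoferTrubowitz1998, App. A elliptic case (arXiv p.31 L101–106, L150–161)] -/
theorem morseC2_elliptic_jacobian (hν : ContDiff ℝ 2 ν) (h1 : fderiv ℝ ν 0 = 0)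
    (h11 : iteratedFDeriv ℝ 2 ν 0 ![((1 : ℝ), (0 : ℝ)), ((1 : ℝ), (0 : ℝ))] = 1)
    (h12 : iteratedFDeriv ℝ 2 ν 0 ![((1 : ℝ), (0 : ℝ)), ((0 : ℝ), (1 : ℝ))] = 0)
    (h22 : iteratedFDeriv ℝ 2 ν 0 ![((0 : ℝ), (1 : ℝ)), ((0 : ℝ), (1 : ℝ))] = 1) :
    Tendsto (fun p : ℝ × ℝ => (p.1 * fderiv ℝ ν p ((1 : ℝ), (0 : ℝ)) +
      p.2 * fderiv ℝ ν p ((0 : ℝ), (1 : ℝ))) / (p.1 ^ 2 + p.2 ^ 2)) (𝓝[≠] 0) (𝓝 1) := by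
  have hess := morseC2_hess_apply_elliptic hν h11 h12 h22
  -- the remainders `∂ᵢν(p) - pᵢ = o(|p|)`
  have key : ∀ w : ℝ × ℝ, (fun p : ℝ × ℝ => fderiv ℝ ν p w - (p.1 * w.1 + p.2 * w.2))
      =o[𝓝 0] fun p : ℝ × ℝ => ‖p‖ := by
    intro w
    have h := (morseC2_hasFDerivAt_partial hν w 0).isLittleO
    refine (h.congr' ?_ ?_).norm_right
    · filter_upwards with p
      simp [h1, ContinuousLinearMap.flip_apply, hess]
    · filter_upwards with p
      simp
  have k1 := key ((1 : ℝ), (0 : ℝ))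
  have k2 := key ((0 : ℝ), (1 : ℝ))
  simp only [mul_one, mul_zero, add_zero, zero_add] at k1 k2
  have b1 : (fun p : ℝ × ℝ => p.1) =O[𝓝 0] fun p : ℝ × ℝ => ‖p‖ :=
    IsBigO.of_bound 1 (Eventually.of_forall fun p => by
      simpa [Real.norm_eq_abs] using norm_fst_le p)
  have b2 : (fun p : ℝ × ℝ => p.2) =O[𝓝 0] fun p : ℝ × ℝ => ‖p‖ :=
    IsBigO.of_bound 1 (Eventually.of_forall fun p => by
      simpa [Real.norm_eq_abs] using norm_snd_le p)
  have hnum : (fun p : ℝ × ℝ => (p.1 * fderiv ℝ ν p ((1 : ℝ), (0 : ℝ)) +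
      p.2 * fderiv ℝ ν p ((0 : ℝ), (1 : ℝ))) - (p.1 ^ 2 + p.2 ^ 2)) =o[𝓝 0]
      fun p : ℝ × ℝ => p.1 ^ 2 + p.2 ^ 2 := by
    have h := (b1.mul_isLittleO k1).add (b2.mul_isLittleO k2)
    have hden : (fun p : ℝ × ℝ => ‖p‖ * ‖p‖) =O[𝓝 0] fun p : ℝ × ℝ => p.1 ^ 2 + p.2 ^ 2 := by
      refine IsBigO.of_bound 1 (Eventually.of_forall fun p => ?_)
      rw [Real.norm_eq_abs, Real.norm_eq_abs, abs_of_nonneg (by positivity),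
        abs_of_nonneg (by positivity), one_mul]
      exact norm_sq_le_sum_sq p
    refine (h.trans_isBigO hden).congr' ?_ (Eventually.of_forall fun _ => rfl)
    filter_upwards with p
    ring
  have ht := (hnum.tendsto_div_nhds_zero.mono_left
    (nhdsWithin_le_nhds (s := ({(0 : ℝ × ℝ)}ᶜ : Set (ℝ × ℝ))))).add
    (tendsto_const_nhds (x := (1 : ℝ)))
  rw [zero_add] at ht
  refine ht.congr' ?_
  filter_upwards [self_mem_nhdsWithin] with p hp
  replace hp : p ≠ 0 := hp
  have hden : p.1 ^ 2 + p.2 ^ 2 ≠ 0 := by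
    intro h
    apply hp
    have h1' : p.1 = 0 := by nlinarith [sq_nonneg p.1, sq_nonneg p.2]
    have h2' : p.2 = 0 := by nlinarith [sq_nonneg p.1, sq_nonneg p.2]
    exact Prod.ext h1' h2'
  field_simp
  ring

/-- **[II] Appendix A, elliptic case — "`R(0,0) = 0`, `R` is increasing on each fixed ray
`θ = const`"** (p.31 L101–104, L139–148): for `ν ∈ C²` with `ν(0) = 0`, `Dν(0) = 0`,
`D²ν(0) = 1`, on a punctured neighbourhood of `0` the function `t ↦ ν(t p)` is strictly
increasing on `[0, 1]` and in particular `ν(p) > 0`; so `R = ν` and the polar angle are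
coordinates near `0` with `ν = R = ½(x² + y²)` for `x = √(2R) cos θ`, `y = √(2R) sin θ`
(p.31 L111–120; that tautological rewriting and the Jacobian `∂(x,y)/∂(φ₁,φ₂) = 1 + o(1)` of
p.31 L121–127, L163–170 are not typed separately — the content is this statement and
`morseC2_elliptic_jacobian`).
[cite: FeldmanSalmhoferTrubowitz1998, App. A elliptic case (arXiv p.31 L90–110, L139–148)] -/
theorem morseC2_elliptic_radial (hν : ContDiff ℝ 2 ν) (h0 : ν 0 = 0) (h1 : fderiv ℝ ν 0 = 0)
    (h11 : iteratedFDeriv ℝ 2 ν 0 ![((1 : ℝ), (0 : ℝ)), ((1 : ℝ), (0 : ℝ))] = 1)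
    (h12 : iteratedFDeriv ℝ 2 ν 0 ![((1 : ℝ), (0 : ℝ)), ((0 : ℝ), (1 : ℝ))] = 0)
    (h22 : iteratedFDeriv ℝ 2 ν 0 ![((0 : ℝ), (1 : ℝ)), ((0 : ℝ), (1 : ℝ))] = 1) :
    ∀ᶠ p in 𝓝[≠] (0 : ℝ × ℝ), StrictMonoOn (fun t : ℝ => ν (t • p)) (Icc 0 1) ∧ 0 < ν p := by
  have hJ := morseC2_elliptic_jacobian hν h1 h11 h12 h22
  have hhalf : ∀ᶠ p in 𝓝[≠] (0 : ℝ × ℝ), 1 / 2 < (p.1 * fderiv ℝ ν p ((1 : ℝ), (0 : ℝ)) +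
      p.2 * fderiv ℝ ν p ((0 : ℝ), (1 : ℝ))) / (p.1 ^ 2 + p.2 ^ 2) :=
    hJ.eventually (Ioi_mem_nhds (by norm_num))
  rw [eventually_nhdsWithin_iff, Metric.eventually_nhds_iff] at hhalf
  obtain ⟨r, hr, hhalf⟩ := hhalf
  have hball : ∀ᶠ p in 𝓝 (0 : ℝ × ℝ), dist p 0 < r := Metric.ball_mem_nhds 0 hr
  have hmem : ∀ᶠ p in 𝓝[≠] (0 : ℝ × ℝ), p ≠ 0 ∧ dist p 0 < r :=
    ((hball.filter_mono nhdsWithin_le_nhds).and self_mem_nhdsWithin).mono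
      fun p h => ⟨h.2, h.1⟩
  filter_upwards [hmem] with p ⟨hp0, hpr⟩
  have hS : 0 < p.1 ^ 2 + p.2 ^ 2 := by
    rcases ne_or_eq p.1 0 with h | h
    · positivity
    · have h2 : p.2 ≠ 0 := fun h2 => hp0 (Prod.ext h h2)
      positivity
  -- the radial derivative is positive for `0 < t ≤ 1`
  have hderiv : ∀ t : ℝ, 0 < t → t ≤ 1 → 0 < fderiv ℝ ν (t • p) p := by
    intro t ht ht1
    have hq0 : t • p ≠ 0 := smul_ne_zero ht.ne' hp0
    have hqr : dist (t • p) 0 < r := by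
      rw [dist_zero_right, norm_smul, Real.norm_eq_abs, abs_of_pos ht]
      rw [dist_zero_right] at hpr
      nlinarith [norm_nonneg p]
    have h := hhalf hqr hq0
    simp only [Prod.smul_fst, Prod.smul_snd, smul_eq_mul] at h
    have hden : 0 < (t * p.1) ^ 2 + (t * p.2) ^ 2 := by
      have : (t * p.1) ^ 2 + (t * p.2) ^ 2 = t ^ 2 * (p.1 ^ 2 + p.2 ^ 2) := by ring
      rw [this]; positivity
    have h' := (lt_div_iff₀ hden).1 h
    rw [lin_prod_apply]
    nlinarith [mul_pos ht hS]
  have hcont : ContinuousOn (fun t : ℝ => ν (t • p)) (Icc 0 1) := fun t _ =>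
    (morseC2_hasDerivAt_ray hν p t).continuousAt.continuousWithinAt
  have hmono : StrictMonoOn (fun t : ℝ => ν (t • p)) (Icc 0 1) := by
    refine strictMonoOn_of_deriv_pos (convex_Icc 0 1) hcont fun t ht => ?_
    rw [interior_Icc] at ht
    rw [(morseC2_hasDerivAt_ray hν p t).deriv]
    exact hderiv t ht.1 ht.2.le
  refine ⟨hmono, ?_⟩
  have := hmono ⟨le_rfl, zero_le_one⟩ ⟨zero_le_one, le_rfl⟩ zero_lt_one
  simpa [h0] using this

end Elliptic

end Literature.MathematicalPhysics.QuantumLattice.FermiRG
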